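import Summits.Langlands.Langlands.Theses.PicardMuOrdinary
import Literature.NumberTheory.Automorphic.AlgebraicityTwist
import Literature.NumberTheory.Automorphic.ClozelAlgebraicityComplexConjArch
import Literature.NumberTheory.Automorphic.AutomorphicRepsGLSatakeFlathProofs
import Literature.NumberTheory.Automorphic.UnitaryGroupAutomorphicRep
import Literature.NumberTheory.Automorphic.AsaiSign
import Literature.NumberTheory.Automorphic.SatakeParamNeZeroProofs
import Literature.AlgebraicGeometry.Motives.PicardCurveMuOrdinaryReduction

/-!
# Disproof attempts — crux `IrregularClassicality` (stmt-Langlands-13758, route `PicardMuOrdinary`)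

Standing disprover's work file (cdisprove; cycle 1: refuter-cdisprove-stmt-Langlands-13758-0,
cycle 2: …-g2-0, cycle 3: …-g3-0, cycle 4: …-g4-0).  Prose only in docstrings; everything
below is `lean check`ed (rc 0, no `sorry`, standard axioms).  VERDICT SO FAR: NO KILL — the crux
is the target X weakened by a hypothesis, X is reciprocity (B) for ONE explicit geometric
3-dimensional `G_K`-system (item 16), and the typing has been audited clause by clause (items 4,
10, 11, 14–16); what the file offers provers is the anatomy of the hypothesis: which towers make
the crux trivially true (stationary §3, recurring / finite eigensystem range §8), which conjuncts
carry its content (`u ∉ 𝔐` §2, `3 ∈ 𝔐` §9, regularity / maximality §10), which normal forms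
they may assume (fixed embedding §5/§7, large `S` §6, infinitely many `k` §2), the rigid shape of
polarized parameters at `c`-fixed places and the INERT SUPERSINGULAR FACTOR of every Picard curve
(§12, items 21–23), and — cycle 4, for the PICKED line `split-ramified-prime-sqrt6` — the EMPTY
case split (curve-level μ-ordinarity), the remainder stub as a costume of the crux, the
load-bearing hypotheses of its Stub 1, the `±1`-shape of the restated (twisted-polarized)
interface at inert primes, and the first admissible μ-ordinary-JACOBIAN anchor `f_BBW` (§13,
items 24–28).
Landed so far: `Theorems/IrregularClassicality/Negative/StationaryCollapse.lean` (p72665),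
`…/Negative/EmbeddingWLOG.lean` (p73625); cycle 2: `…/Negative/FiniteRangeCollapse.lean` (p74976)
and `…/Negative/NormalForm.lean` (p76394); cycle 3: `…/Negative/InertFactor.lean` (in tree);
cycle 4 (all ACCEPTED): `…/Negative/NonMuOrdinaryRemainderCostume.lean` (p81646),
`…/Negative/PlaceOfMaximalIdealTightness.lean` (p81720), `…/Negative/ConjSelfDualInertShape.lean` (p81768).

## Findings (cycle 4, 2026-08-16) — items 24–28 (PICKED line `split-ramified-prime-sqrt6`)

24. **The PICKED line's case split is on an EMPTY predicate (drefute finding, CONFIRMED here from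
   print; kernel-checked consequences in §13).**  Lead `prover-line-stmt-Langlands-13758-0` picked
   `Lines/split-ramified-prime-sqrt6.lean` (7 stubs; composition `IrregularClassicality_of` =
   `by_cases HasMuOrdinaryReductionAtThree f`).  Börner–Bouw–Wewers 2017, §3.2 Lemma 4
   (`lem:genuscomp`, arXiv:1701.01986 p. 6, read verbatim this cycle): over the absolutely
   unramified `K = ℚ₃^{nr}` an étale genus-3 component of the stable reduction of `y³ = f(x)` has
   ONE branch point (lower jump 4); the two-branch-point case (jumps 1, 2) "does not occur" — `τ :
   ζ₃ ↦ ζ₃²` normalises `σ`, fixes both ramification points, and the linearised constraint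
   `ζ^{h_i} = -1` at `h₁ = 1`, `h₂ = 2` forces the order of `τ` to be 2 and 4 at once (shadow:
   `no_tau_for_jumps_one_two`).  So a Picard curve over `ℚ` with potentially good reduction at 3
   reduces to the Hermitian curve `y³ - y = x⁴` (supersingular, 3-rank 0; BBW Ex. 1, `m = 8`,
   `f₃ = 6`), and the tree predicate `HasMuOrdinaryReductionAtThree` (D1: CURVE-level good
   reduction of 3-rank 2, honest fields `IsPicardCurve`/`IntegralModel`/point counts) holds for NO
   separable quartic `f ∈ ℤ[X]`.  Kernel-checked under that hypothesis (`CurveLevelVacuity`, not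
   provable in the tree): Stub 7 `stub_nonMuOrdinaryRemainder` ↔ the crux
   (`nonMuOrdinaryRemainder_iff_of_vacuity`; unconditionally crux → Stub 7), and EVERY stub guarded
   by the predicate — Stub 3 `stub_polarizedTwistedTower`, the heart Stub 5
   `stub_twoWallOrdinaryClassicality` — is vacuously true (`guardedStub_of_vacuity`,
   `guardedStub_of_vacuity'`).  The same split sits in `Lines/sen-cousin-anisotropic-saddle.lean`
   and in 13757's lines.  FOR THE CRUX: nothing changes (no slope hypothesis; still implied by X).
   FOR PLANNERS re-typing D1 / filing the foreseen μ-ordinary–remainder split of 13758 or 13757: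
   the engine (Hida theory on the unitary Shimura variety) sees only `J(C_f)` / `ρ_C`, never `C_f`
   — type μ-ordinarity on the JACOBIAN (BBW stable type (b): compact type, `J` potentially good
   with Newton polygon `(0,0,½,½,1,1)`) or, simplest for this line, on the GALOIS side as a
   predicate on Stub 2's `ρ` (a `G_{K_λ}`-stable filtration with rank-1 graded pieces of slopes
   `0, ½, 1` up to finite order), so that the remainder is honestly "`ρ_C` not μ-ordinary at `λ`".
25. **`f_BBW = 3x⁴ + x³ - 54` — the first ADMISSIBLE anchor with μ-ordinary JACOBIAN at 3** (BBW
   2017 §3.3 Example 2, pp. 8–9 read: semistable over `L₄ = K(π)`, `π⁴ = -3`, stable type (b),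
   `f₃ = 4`; components `W₁ : z³ - z = -x - 1/x` (genus 2) and `W₂ : y³ - y = x²` (genus 1,
   supersingular) meeting in one point ⇒ `J` potentially GOOD of Newton polygon `(0,0,½,½,1,1)`).
   Certified here (folder `compute/`, pure integer arithmetic, evidence `bbw_anchor_evidence.txt`):
   `disc f_BBW = -2²·3⁹·5²·7·79` (non-square), no rational root, Frobenius cycle types `(4)` at
   `p = 11` and `(3,1)` at `p = 29` ⇒ irreducible with `Gal = S₄` — ADMISSIBLE (`12 ∣ 24`);
   `f(-1/4) = -13825/256 < 0` is the global minimum (`f' = 3x²(4x+1)`) ⇒ exactly TWO real roots ⇒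
   the projectively odd (Langlands–Tunnell) residual branch; `a_𝔭(f_BBW) ≠ 0` at all 19 split
   `p < 200` (non-CM), inert values obey `-3p ≤ a_p ≤ p` and `BranchPointCongruence`, none in
   `{p, -3p}`.  λ-DISTINGUISHEDNESS IS DESCENT-DEPENDENT: brute-force counts (`N_m = 2, 20, 44, 68`,
   Newton-consistent) give `L(W₁/𝔽₃, T) = (1 - T + 3T²)²` — 3-rank 2, ordinary, but unit root
   `u ∈ ℤ₃` (root of `X² - X + 3`) with multiplicity 2: NOT distinguished for BBW's descent
   `π⁴ = -3` (nor over any `𝔽_{3^d}`); the other tame descent `π'⁴ = +3` (worked out here: special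
   fibre `ȳ³ + x̄²ȳ = x̄⁴ + 1`, component `W₁' : z³ + z = x - 1/x`) has
   `L = (1 - T + 3T²)(1 + T + 3T²)`, unit roots `{u, -u}` DISTINCT (equal again over `𝔽_{3^d}`,
   `d` even) — the two descents differ by the monodromy `τ|_{W₁} : (x,z) ↦ (-x,-z)`, which swaps
   the `ω`-eigenspaces.  So the repaired predicate holds at `f_BBW` in the existential-over-`M`
   reading of D1's docstring, and a "minimal field"/"every `M`" reading would wrongly exclude it.
   NOTE for the re-typing: inside `V_e` the slope-0 part has rank ONE, so BCGP-style
   `p`-distinguishedness is automatic; D1's `u ≠ ū` compares `V_e` with `V_ē` — planners should say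
   which distinctness the engine actually needs (13757's business; recorded, not pursued).
26. **Stub 1 `stub_placeOfMaximalIdeal` (TRUE — drefute's paper proof; provable now): both
   hypotheses on `𝔐` are load-bearing, KERNEL-CHECKED** (§13): without `3 ∈ 𝔐`, a maximal `𝔐`
   above 2 admits `u := 3 ∉ 𝔐` for every `z`, forcing `‖ι⁻¹ 1‖ = 1 ≤ 3⁻¹`
   (`placeOfMaximalIdeal_false_without_three_mem`); with `IsMaximal` weakened to "proper", `𝔐 = 3ℤ̄`
   and `z = u = √3` (`u ∉ 3ℤ̄` as 3 is not a unit; `u z = 3`) would need `‖ι⁻¹ √3‖ ≤ 3⁻¹`, but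
   `‖ι⁻¹ √3‖² = ‖3‖ = 3⁻¹` for EVERY `ι` (`placeOfMaximalIdeal_false_without_isMaximal`) — the
   maximality conjunct is what pins ONE 3-adic place (item 15 / §10, now with a witness).
27. **Pre-audit of the RESTATED interface** (twisted-polarized normal form = Stub 3's conclusion:
   members `Π_k` regular algebraic cuspidal, `IsConjSelfDualAE c₀`, `N𝔭·ΣSat(Π_k,𝔭) ≡ e(a_𝔭(f)·ϖ_𝔭)`
   with `ϖ_𝔭` primary; recommended by all three line cards, the parity note and the drefute).  (a) It
   changes the HYPOTHESIS only: the restated crux (`IrregularClassicalityTwisted`, §13) is still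
   implied by X (`irregularClassicalityTwisted_of_picardAutomorphy`; no `_false_without_` room)
   and, on paper, by the current crux (untwist `Π_k ⊗ ψ⁻¹`; in-tree this needs the CM character
   `ψ` as a `HeckeCharacter` plus `CuspidalAutomorphicRepData.twist`'s Satake bookkeeping — not
   built); the restated hypothesis is honest and satisfiable on paper (primary generators exist
   uniquely: `𝓞_K` is a PID, `±ω^i` are distinct mod 3; at inert `(p)`, `ϖ = -p`).  (b)
   UNCONDITIONAL shape theorem (§13, `one_mem_or_neg_one_mem_satake_of_isConjSelfDualAE`, from the
   tree's `hasSatakeParamAt_ne_zero_holds` + an odd-cardinality involution lemma): a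
   conjugate-self-dual `Π` on `GL₃/E` has `1 ∈ Sat(Π,w)` or `-1 ∈ Sat(Π,w)` at almost every
   `c`-fixed `w` — GL₃-side twin of §12(a).  Paper complement with §12(b): at an inert `𝔭 = (p)`
   the Galois-side limit makes `N𝔭·Sat(Π_k,(p))` converge 3-adically to `{p², -pγ, -p³/γ}` (the
   spectrum of `(ρ_C ⊗ ψ)(Frob_𝔭)`, `ϖ_{(p)} = -p`, `{-p, γ, p²/γ}` on `V_e`), so whenever
   `a_𝔭(f) ∉ {p, -3p}` (i.e. `γ ≠ ±p`) the self-inverse parameter is eventually `+1` and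
   `p² b_k → -pγ`: a candidate tower with parameter `-1` at infinitely many such inert primes is
   inadmissible — a cheap numerical test for 13757's provers.  (c) Parity threshold decide-checked:
   `(1 + 3y)³ = 1` in `ZMod 9` for all `y`, but `4³ = 10 ≠ 1` in `ZMod 27`
   (`cube_of_one_mod_three_mod_nine`, `exists_cube_of_one_mod_three_ne_one_mod_twentyseven`): an
   UNTWISTED exactly polarized regular `P` matches `ρ_C` to depth `k ≤ 3` at most, as the parity
   note says.
28. Literature / negatives (cycle 4): BBW2017 pp. 6–9 read (items 24–25); searchd rc 75, OpenAlex
   429, galaxy 0 rows for "modularity of Picard curves" / "Picard curves are automorphic"; zbMATH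
   + arXiv up: no automorphy theorem for Picard curves, no irregular-weight classicality for
   `U(2,1)` at a ramified prime (nearest: Fan, arXiv:2511.09125, Newton strata — geometry);
   `ledger negatives --problem Langlands` unchanged (1 unrelated entry).  Verdict unchanged: NO
   KILL; the cycle-4 defects are LINE-level (empty case split), not crux-level.

## Findings (cycle 3, 2026-08-16) — items 21–23

21. **Registered skeleton audited — `Lines/sen-kills-cousin-on-p2.lean` (6 active stubs T, A, N,
   B, C, M; composition `IrregularClassicality_of` kernel-checked; `payload.stuck_stubs = []`, no
   lead cycle yet).**  Cheap attacks, stub by stub (details in `## Targets` below): no stub is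
   refutable or closable in the tree — every conclusion is an `∃` over Borel–Jacquet data
   (`CuspidalAutomorphicRepData`, `UnitaryGroup.CuspidalAutomorphicRepData`) or consumes a
   `FramedGaloisRep` with infinite, strongly irreducible image that the tree cannot construct; the
   interfaces they quantify over were RE-READ and are honest (FLT-style `FramedGaloisRep` =
   continuous `Γ_K →ₜ* GL₃`, `IsUnramifiedAt` via inertia groups of primes of `\bar ℤ_K`,
   `IsArithFrobAt` + `trace ρ τ⁻¹` = GEOMETRIC Frobenius trace, consistent with item 16;
   `HeckeCharacter` = continuous idele class characters with `valueAtUniformizer ∈ ℂˣ`;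
   `UnitaryGroup.HasBaseChangeSatakeAt` = explicit Hecke-eigenvalue condition with torus
   parameters subject to `IsBaseChangeParam`).  Shape facts proved: Stub N's conclusion forces
   `3 ∣ n` (`three_dvd_of_finEquiv`); at a `c`-fixed place the unitary base-change multiset is
   `{b, 1, b⁻¹}` (`hasBaseChangeSatakeAt_three_of_fixed`) — item 22.
22. **Inert supersingular factor (§12; paper lemma + numerics + two kernel-checked shadows).**  At
   every inert good prime `𝔭 = (p)` of EVERY Picard curve, `Frob_𝔭 = Frob_p²` on `V_e` has the
   eigenvalue `-p`: `P_e(T) = (T + p)(T² - (a_𝔭 + p)T + p²)`, `det = -p³`, `T² + p ∣ L_{C/𝔽_p}(T)`,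
   `tr(F²|V_e) = a_𝔭(a_𝔭 + 2p)`, `-3p ≤ a_𝔭 ≤ p`.  Proof: `Frob_p` swaps `V_e`, `V_ē` (so `F|V_e = AB`,
   `F|V_ē = BA` share `P_e ∈ ℤ[T]`), `det(0 A; B 0) = -det A det B` for odd block size
   (`det_fromBlocks_zero_diag_three`) and `det(Frob_p|H¹) = p³` give `det = -p³`; Weil duality
   `V_ē ≅ V_e^∨(-1)` closes the eigenvalues under `γ ↦ p²/γ`; closure + det force the root `-p`
   (`root_neg_p_of_closure_of_det`).  Certified on 62 (f, p) cases, 0 exceptions, plus an independent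
   brute-force `L`-polynomial.  Consequences: (i) the line's twisting character is pinned at inert
   primes, `χ((p)) = -p` (the Grössencharacter of `y² = x³ + D`), not free; (ii) the unitary avatar
   has `Frob_𝔭`-eigenvalue exactly `N𝔭` at inert `𝔭`, matching the rigid middle parameter `1` — the
   corrected interface is CONSISTENT where the discarded `IsConjSelfDualAE` restate is not (parity,
   re-derived; first obstruction at `k = 3` rather than `2` for `A₄`-quartics with resolvent field
   `ℚ(ζ₉)⁺`); (iii) nothing changes for the crux (no self-duality in its `GL₃` tower).  Nearest print
   located: Sutherland, arXiv:2004.10189 §2 Thm. 8 (block anti-diagonal Cartier–Manin matrix of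
   `y^m = f(x)` for `p ≢ 1 mod m`, `tr A_p = 0`) — the mod-`p` shadow; the `ℓ`-adic statement with
   the sign is elementary and recorded here as folklore.
23. Literature / negatives (cycle 3): local searchd rc 75, OpenAlex and S2 HTTP 429 (degraded);
   arXiv + zbMATH up: no automorphy theorem for Picard curves (route kill criterion 5 not
   triggered; nearest new item Fan 2025, arXiv:2511.09125, Newton strata of Picard modular
   surfaces — geometry, not lifting), no irregular-weight classicality for `U(2,1)` at a ramified
   prime; `ledger negatives` unchanged when reachable.  Verdict unchanged and independent of the
   degraded services: NO KILL; the crux closes `exhausted`/proved, never `refuted`, unless mistyped,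
   and the typing audit (items 4, 10, 11, 14–16, 21) found no defect.

## Findings (cycle 2, 2026-08-16) — items 13–18 (cycle-1 items 1–12 follow)

13. **Recurrence and finite range — PROVED, unconditional (§8).**  Uniqueness of Satake
   parameters is a theorem of the tree (`AutomorphicRepData.hasSatakeParamAt_unique_holds`,
   Flath), so §3 sharpens drastically: if ONE Satake eigensystem off `S` recurs at infinitely many
   depths of the tower — the serving `P`, its witnesses `α, t, u` and the datum all free to vary
   with the depth — the match is exact and the conclusion holds
   (`exactRegularMatch_of_eigensystemRecurs`, `automorphy_of_eigensystemRecurs`; special case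
   `automorphy_of_recurringMember`: one `P` serving infinitely many depths).  By pigeonhole
   (`Finite.exists_infinite_fiber`) the crux therefore HOLDS for every tower whose members'
   eigensystems range over a finite set (`FiniteEigensystemRange`,
   `irregularClassicality_finiteRange`).  Contrapositive for provers: a tower on which the crux
   has content runs through INFINITELY MANY distinct eigensystems; with Harish-Chandra finiteness
   (`harishChandra_finiteness_gl`, a named fact) + strong multiplicity one, bounded infinity type
   AND bounded level would give finite range, so weight or `S`-level is unbounded — and bounded
   (regular) infinity type is impossible on paper anyway by Sen's continuity theorem (item 9).  This
   is also the formal core ("pigeonhole + rigidity") of the ideators' stub `FixedTypeTowerAutomorphy`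
   (card hasse-division-tower, P1), proved here for regular members without any finiteness fact.
14. **`3 ∈ 𝔐` is the entire coupling to the curve — PROVED (§9).**  `e(a_𝔭(f))` is an algebraic
   integer (`isIntegral_embedding_picardTrace`), so depth `0` of the tower is the `f`-FREE property
   "`N𝔭·Σα(P,𝔭) ∈ ℤ̄` for `𝔭 ∉ S`" of some regular algebraic cuspidal `P` (`layer_zero_iff`), and
   for `𝔐 ∌ 3` (prime) every depth is depth `0` (`u := 3^k`; `layer_iff_layer_zero_of_three_not_mem`).
   Hence deleting the conjunct `3 ∈ 𝔐` (a maximal `𝔐` above `2` becomes admissible,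
   `exists_isMaximal_two_mem_three_not_mem`) turns the hypothesis into `∃ S, IntegralRegularCuspidal
   hcpt S` (`limitHypothesisWithout3_iff`) and the crux into "(an integral regular cuspidal `P` on
   `GL₃/ℚ(ω)` exists) → X" LITERALLY (`irregularClassicalityWithout3_iff`); the variant sits between
   X and the crux (`…Without3_of_picardAutomorphy`, `irregularClassicality_of_without3`) and is X on
   paper.  So the only `f`-dependent, `3`-adic content of the hypothesis is carried by `3 ∈ 𝔐`
   together with `u ∉ 𝔐` (item 6); the genuine hypothesis implies the integrality property
   (`integralRegularCuspidal_of_limitHypothesis`).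
15. **Remaining conjuncts (§10).**  `IsRegularAlgebraic` deleted: again between X and the crux
   (`irregularClassicality_of_anyType`); on paper met by the stationary tower `π_C ⊗ |det|`, i.e. X in
   disguise — regularity is load-bearing for the ROUTE (it is what 13757 outputs and what forces
   non-stationarity), not for truth.  `IsMaximal` weakened to a proper ideal `∋ 3` (e.g. `3ℤ̄`):
   `u ∉ 3ℤ̄` only makes `u` a unit at SOME place above `3`, free to wander with `(k, 𝔭)`, so the
   congruences would no longer sit at one `3`-adic place — a genuinely stronger variant of unclear
   truth, no finite model; recorded, not pursued.
16. **Coherence of `a_𝔭(f)` across `𝔭` — proved on paper (closing the last typing door of X).**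
   Twisted Lefschetz for `Φ_j = F_q ∘ ū^{-j}` on `C : y³ = f(x)` over `𝓞_K/𝔭 ∋ ζ = ω mod 𝔭`
   (`u : y ↦ ωy` the GLOBAL automorphism, `𝔭 ∤ 3·disc·lead`): all three roots `y` of `y³ = a`,
   `a ∈ 𝔽_q^×`, satisfy `y^{q-1} = a^{(q-1)/3} = χ_q(a)`, so `#Fix Φ_j = 1 + r + 3·#{x : χ_q(f(x)) = ζ^j}`
   and `tr(F_q^* | H¹[ū^* = ι(ω)]) = -Σ_{x} ι(χ_𝔭(f(x))) = ι(a_𝔭(f))` for EVERY embedding `ι` of `K`,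
   with `χ_𝔭` exactly the tree's `cubicResidueSymbol` (unique `μ ∈ μ₃(𝓞_K)` with
   `μ ≡ a^{(N𝔭-1)/3}`, `χ_𝔭(0) = 0`) and `picardTrace = -Σ χ_𝔭(f̄(x))` (definitions re-read).  The
   eigenspace `V_ι = H¹_ét(C_{K̄}, ℚ̄_ℓ)[u^* = ι(ω)]` is a `G_K`-stable 3-dimensional summand defined
   GLOBALLY, so `𝔭 ↦ ι(a_𝔭(f))` is the (geometric-)Frobenius trace of ONE `G_K`-representation for
   all good `𝔭`: X is precisely conjunct (B) for `V_e`, L-algebraic weight `{0,0,1}|{0,1,1}`, cuspidal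
   because `V̄_e` is the absolutely irreducible reflection representation.  Hence NO counterexample
   to X — a fortiori to the crux — exists unless `GL₃` reciprocity over `ℚ(ω)` fails; every kill
   must be a typing kill, and the typing is now audited clause by clause: `natDegree`/non-monic/
   content (cubic twists, harmless), `12 ∣ #Gal` (`Gal` is a `Fintype`, so `A₄/S₄`, irreducible;
   `K ⊂ Split f` allowed and harmless), one place above `x = ∞` (`3 ∤ 4`), bad and `λ`-adic `𝔭`
   absorbed by `∀ᶠ cofinite`, `IsLAlgebraic` (integral Hodge exponents), `|det|^s`-twists stay
   cuspidal in the tree (`exists_twist_hasInfinityType`), `hcpt` proof-irrelevant.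
17. **Idea cards, round 1 (7 read: sen-kills-cousin-on-p2, minuscule-singular-patching,
   definite-companion-gluing, trivial-coefficient-torsion-bridge, sen-cousin-anisotropic-saddle,
   hasse-division-tower, split-ramified-prime-sqrt6).**  No first lemma is refutable or provable in
   the tree — each quantifies `∃`/`∀` over the Borel–Jacquet datum (`PolarizedLimit`, `PolarizeTower`,
   `PolarizedIrregularClassicality`, `cardA/B/C` seeds, `FixedTypeTowerAutomorphy`), of which no
   closed term and no non-existence theorem exists (item 3).  Disprover's notes for triage/lead:
   (a) the shared debt `PolarizeTower`/`PolarizedLimit` (typed tower ⇒ conjugate-self-dual or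
   base-changed approximants) is NOT a weakening of X — unlike the crux it asserts existence of new
   automorphic data — and on paper it is a polarized big-`R = T` / lifting statement at ramified `3`
   (13757-hard); every `U(2,1)` line inherits it unless the tenure planner adds `IsConjSelfDualAE`
   to the `P_k` of 13757/13758 (the one typing repair all three ideators request); (b)
   `FixedTypeTowerAutomorphy`: core proved here (item 13); as a HYPOTHESIS a fixed regular type is
   empty on paper (Sen), a fixed singular type `(1,1,1)` at fixed level is the honest Bockstein
   end-game; (c) the potentially abelian corner inside `12 ∣ #Gal` (should some admissible `f` have
   a CM Jacobian): `V_e` irreducible of prime dimension with abelian restriction to an open normal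
   subgroup and Hodge–Tate weights `{0,0,1}` is induced, `V_e ≅ Ind_{G_M}^{G_K} ψ` with `M ⊃ K` a CM
   sextic and `ψ` an algebraic Hecke character of `M`, so X holds there on paper by cubic automorphic
   induction `M → K` (cyclic: Arthur–Clozel; non-normal: JPSS 1981, the tree's
   `automorphicInduction_unitaryCharacter_cubic`) — no counterexample from that corner either; the
   corner is EMPTY at small height (all 276 admissible quartics with coefficients in `[-2, 2]` have
   `a_𝔭 = 0` at no more than 1 of their first 50 split primes, versus density `≥ 1/3` for an induced
   `V_e`; folder `compute/cm_scan.py`) but NOT empty: item 20 exhibits the admissible CM member `f₆₇`;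
   (d) nothing in any card contradicts items 5/9/13 (all lines use genuinely varying `P_k` or avoid
   the tower).
19. **One normal form for the lead (§11)**: `irregularClassicality_iff_normalForm e₀ S₀` — fix the
   embedding, assume `S ⊇ S₀ f` for any prescribed finite `S₀ f`, and assume the tower only at
   cofinally many depths; and `irregularClassicality_iff_nonrecurring e₀` — additionally assume NO
   eigensystem recurs (the recurring case is discharged by §8).  These are `↔`, so nothing is lost.
20. **A CM ANCHOR INSIDE THE ADMISSIBLE CLASS — `f₆₇` (cycle 2; settles 17(c)).**  The Picard curve
   `C₆₇ : y³ = f₆₇(x)`, `f₆₇ = x⁴ + 2·7·67·179 x² + 2³·3³·5·67·137 x + 5²·7·67²·71·89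
   = x⁴ + 167902x² + 9913320x + 4964048425`, is DEFINED OVER ℚ with CM by the cyclic sextic
   `M = ℚ(ω)·K₀`, `K₀ : v³ - v² - 22v - 5` (conductor 67) [Lario–Somoza 2016, arXiv:1611.02582 =
   doi:10.1007/s40993-021-00253-1, §4.3 (numerical model); Kılıçer et al. arXiv:1701.06489, Table 1,
   case 35, type P], and `f₆₇` is ADMISSIBLE: irreducible with `Gal(f₆₇) = A₄` (certificate, folder
   `cm67_evidence.txt`, attached: `disc f₆₇ = 15191108269239900404644416000000 = 3897577230696000²`
   exactly; `f₆₇ mod 43 = (2,2)` ⇒ no rational root; `f₆₇ mod 7 = (1,3)` ⇒ no quadratic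
   factorisation; square disc + transitive + 3-cycle ⇒ `A₄`).  CM is corroborated sharply:
   `a_𝔭(f₆₇) = 0` for EXACTLY those of the first 80 split primes `p ≡ 1 (3)` that are non-cubes
   mod 67 (inert in `K₀`), 59 of 80, 0 mismatches — the signature of `V_e ≅ Ind_{G_M}^{G_K} ψ`.
   Consequences: (a) X(`f₆₇`) is TRUE on paper by cyclic cubic automorphic induction of the
   algebraic Hecke character `ψ` of `M` (Arthur–Clozel; no new mathematics) — the CM corner yields
   no counterexample, and `f₆₇` is the natural end-to-end normalisation anchor for the whole route
   (`a_𝔭`, `ψ`, and explicit regular approximants `P_k = AI(ψ·χ₀^{3^{k-1}})` all computable: a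
   recommended kit job for 13757's congruence format — the CM tower is admissible on paper,
   regular, cuspidal, NON-stationary, of unbounded weight, exactly the shape items 9/13 predict, so
   the crux is NON-VACUOUS and true at `f₆₇`); (b) `3` is a cube mod 67, so `λ` splits in `M/K` and
   complex conjugation lies in every decomposition group above `3`: all slopes `½`, `C₆₇` is
   λ-BASIC (supersingular) — it anchors the route's conceded `RTSupersingular` remainder and card
   minuscule-singular-patching's λ-basic seed, NOT the μ-ordinary engine of 13757; (c) for the
   crux as typed (no slope hypothesis) `f₆₇` is an instance where hypothesis and conclusion both
   hold on paper.  (The other rational CM Picard curves of Lario–Somoza §4.1–4.2 have REDUCIBLE `f`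
   — a rational branch point — and are excluded by `12 ∣ #Gal`; checked for the conductor-7, 31,
   63, 63, 117 models: pattern `(1,3)/(1,1,1,1)` only, `a_𝔭 = 0` density ≈ 2/3.)
18. Literature (cycle 2): `ledger negatives --problem Langlands` unchanged (1 unrelated entry);
   barrier catalogue unchanged (`NonRegularWeightBarrier` operative — a technique barrier, not a
   counterexample); `lit search`/searchd degraded all cycle (rc 75), `lit galaxy` up: "CM Picard
   curves" led to Kılıçer et al. arXiv:1701.06489 (Table 1: the complete list of genus-3 curves over
   ℚ with CM by a sextic field; Picard cases 27–35, 37) and Lario–Somoza arXiv:1611.02582 (models),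
   whence item 20; no printed counterexample or negative result bearing on the crux was found, and
   the verdict does not depend on the degraded service.

## Findings (cycle 1, 2026-08-16)

1. **Elaborates.** `IrregularClassicality` is, definitionally (`irregularClassicality_iff`,
   `Iff.rfl`), `∀ f hcpt, natDegree f = 4 → f separable → 12 ∣ #Gal f → LimitHypothesis f hcpt →
   AutomorphyConclusion f hcpt`, where `AutomorphyConclusion` is VERBATIM the conclusion of the
   target `PicardAutomorphy` (`picardAutomorphy_iff`) and `LimitHypothesis` VERBATIM the conclusion
   of `MuOrdinaryFamilyRT`.
2. **The crux is a weakening of the target**: `irregularClassicality_of_picardAutomorphy :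
   PicardAutomorphy → IrregularClassicality`.  Consequently a refutation of the crux IS a
   refutation of X (reciprocity (B) for generic Picard curves over `ℚ(ω)`, or its typing), and no
   `_false_without_<H>` theorem for the limit hypothesis can exist short of that
   (`IrregularClassicalityWithoutLimit ↔ PicardAutomorphy`, `Iff.rfl`).  The limit hypothesis is
   load-bearing for PROVABILITY, not for truth.
3. **No finite / junk model.** Both sides quantify over
   `CuspidalAutomorphicRepData 3 (CyclotomicField 3 ℚ) hcpt`, the honest Borel–Jacquet datum
   (`W' < W ≤ 𝒜₀`, irreducible quotient).  The tree has no closed term of this type and no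
   non-existence theorem about it (every existence / rigidity statement is a named-fact `Prop`),
   so for NO `f` is `LimitHypothesis f hcpt` provable or `AutomorphyConclusion f hcpt` refutable:
   a counterexample cannot be certified in the tree whatever its truth.  Degenerate parameters
   (`f` reducible, `Gal f ∈ {V₄, C₄, D₄}`, CM quartics such as `x⁴ - 1`) are excluded by
   `12 ∣ #Gal`; inside the generic class `ρ_{C,λ}|_{G_K}` is residually the reflection
   representation of `A₄`/`S₄` on `𝔽₃³`, absolutely irreducible, so cuspidality of the sought `π`
   is the expected answer for EVERY admissible `f` (no reducible member to exploit).
4. **Normalisations are mutually consistent — PROVED** (`automorphy_of_exactRegularMatch`): an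
   exact regular-algebraic match `N𝔭 · Σα(P, 𝔭) = e(a_𝔭(f))` (`𝔭 ∉ S`) already yields the
   conclusion, via the tree's Borel–Jacquet twist `P ⊗ |det|_𝔸^{-1}`
   (`CuspidalAutomorphicRepData.exists_twist_hasInfinityType`, Satake parameters `q_𝔭 · α` by
   `AutomorphicRepData.HasSatakeParamAt.of_map_mulChar_detTwist_of_cpow`) and
   `C-algebraic = L-algebraic` for `n = 3` (`isCAlgebraic_iff_isLAlgebraic_three`).  So the
   route's kill criterion (6) ("attack the normalisations `N𝔭·Σα` vs `Σα`") finds nothing: the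
   L-algebraic / `m = 1` convention of the conclusion is exactly the `|det|⁻¹`-twist of the
   C-normalised hypothesis.  On paper: for `n = 3` the exponents of a C-algebraic type lie in
   `(3-1)/2 + ℤ = ℤ`.
5. **Rigidity of the congruence tower — PROVED** (`eq_zero_of_forall_congr`): in
   `ℤ̄ = integralClosure ℤ ℂ`, if `∀ k, ∃ u ∉ 𝔐, u · t ∈ (3^k)` (`𝔐` maximal, `3 ∈ 𝔐`) then
   `t = 0`.  Hence a STATIONARY family (one `P` and one Satake witness per `𝔭` serving every `k`)
   is an exact match and the crux HOLDS for it (`automorphy_of_stationaryLimit`,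
   `irregularClassicality_stationary`).  On paper the stationary case is EMPTY: `r(P)` has
   regular Hodge–Tate weights while `ρ_C` has `{0,0,1}` (Chebotarev + Brauer–Nesbitt would force
   `r(P)^{ss} ≅ ρ_C`), i.e. `Literature.Barriers.Langlands.NonRegularWeightBarrier` kills the
   only cheap proof.  Any proof must therefore use genuinely varying `P_k` (unbounded weight, or
   unbounded level at `S`) — a `3`-adic limit OBJECT for which the tree has no type (no
   eigenvariety / higher-Hida / completed-cohomology interface for `U(2,1)` or `GL₃/K`).  This is
   why the crux resists proof; item 3 is why it resists disproof.
6. **Hypothesis anatomy** (`layer_antitone`, `limitHypothesis_of_exactRegularMatch`,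
   `layerWithoutUnit_of_layer_zero`): layers are antitone in `k` (so `∀ k` = "for infinitely many
   `k`"); the unit condition `u ∉ 𝔐` is what makes the tower non-trivial (drop it and layer `0`
   gives every layer with `u = 0`); `𝔐 ∋ 3` maximal exists (`exists_isMaximal_three_mem`).  The
   condition `∃ u ∉ 𝔐, u t ∈ (3^k)` is exactly `v_𝔐(t) ≥ k · v_𝔐(3)` for the (rank-one,
   ℚ-valued) valuation of `ℤ̄_𝔐` — an honest `3^k`-congruence, not exploitable.
7. **What the typed hypothesis does NOT carry** (information for planners/provers, not a kill):
   no weight of `P_k`, no level or slope / (μ-)ordinarity condition at `λ = (1-ω)`, no bound on the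
   conductor at `S`; only Frobenius-trace congruences off `S`.  By Chebotarev + Carayol (ρ̄
   absolutely irreducible) this says precisely "`ρ_C mod 3^k` is automorphic of regular weight and
   tame level `S` for every `k`", i.e. the eigensystem of `ρ_C` lies in the `3`-adic closure of the
   regular cuspidal eigensystems of tame level `S`.  "Closure point + geometric ⟹ classical" is
   believed only through Fontaine–Mazur + reciprocity; the one printed irregular classicality
   theorem (BCGP, GSp₄, `p` split, ordinary) uses far more structure than this hypothesis keeps.
8. Negatives index (`ledger negatives --problem Langlands`): 1 entry (K3KugaSatakeDescent anchor),
   unrelated.  Barrier catalogue: `NonRegularWeightBarrier` is the operative one (item 5).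
9. **On paper, every admissible tower has unbounded weight** (sharpening of item 5, not
   formalisable here: needs Galois representations attached to the `P_k`): trace congruences
   `r(P_k) ≡ ρ_C (mod 3^k)` with `ρ̄_C` absolutely irreducible are congruences of representations
   (Carayol); Sen polynomials vary continuously, so a tower with Hodge–Tate weights in a bounded
   window has eventually constant, REGULAR, Hodge–Tate multisets and its limit is de Rham with
   those weights (Berger–Colmez 2008, Astérisque 319) — contradicting `{0,0,1}`.  So the natural
   strengthening "limit of regular cuspidal `P_k` of BOUNDED infinity type" of the hypothesis is
   empty for generic `f`, exactly like the stationary case; the intended towers (sibling crux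
   `MuOrdinaryFamilyRT`, line `weight-blind-lambda-adic-rt`: types `(2·3^m-1, 3^m-1, 0) → (-1,-1,0)`)
   do have weights `→ ∞`.
10. **Conventions of the conclusion checked numerically** (folder `compute/inert_check.py`,
   `compute/split_check.py`, pure arithmetic, no kit job): at INERT `p = 2, 5, 11` (five quartics
   each) `a_𝔭(f) ∈ ℤ` and `a_𝔭(f) = ½·tr(Frob_{p²} | H¹(C)) = tr(Frob_𝔭 | V_e)` (power sums from
   `#C(𝔽_{p^i})`, `i ≤ 3`; the `𝔽_p`-Frobenius swaps the two `ω`-eigenparts, so odd power sums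
   vanish — observed); at SPLIT `p = 7, 13, 19, 31, 37, 43` `2·Re a_𝔭 = tr(Frob_p | H¹)` and
   `|a_𝔭| ≤ 3√p`.  Together with the earlier refuter's split-prime check (route notes) and the
   proved `BranchPointCongruence` shape, the target's `Σα = e(a_𝔭)` convention shows no defect;
   coherence of the eigenpart choice across `𝔭` is Weil's Jacobi-sum mechanism (`χ_𝔭` is the
   reduction of the GLOBAL `μ₃ ⊂ 𝓞_K`), absorbed by `∃ e`.
11. **`∃ e` is innocuous — PROVED** (`automorphyConclusion_iff_fixed`): for either embedding
   `e₀ : ℚ(ω) → ℂ`, `AutomorphyConclusion f hcpt ↔ ∃ π` (cuspidal, L-algebraic) with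
   `Σ Satake(π, 𝔭) = e₀(a_𝔭(f))` a.e.; the two embeddings (`embedding_eq_or_eq_conjugate`,
   `not_isReal`) are exchanged by `π ↦ π̄` (`conclusion_conj`, from the tree's
   `CuspidalAutomorphicRepData.conj`, `HasSatakeParamAt.conj`, `HasInfinityType.conj`).  So the
   existential over embeddings hides no sign/conjugation convention, and provers may fix `e₀`.
   The limit hypothesis is conj-symmetric in the same way (`limitHypothesisAt_conj`: conjugate
   `P_k`, `𝔐 ↦ 𝔐̄` via `conjZbar`, `t, u ↦ t̄, ū`), whence the NORMAL FORM
   `irregularClassicality_iff_fixed e₀ : IrregularClassicality ↔ ∀ generic f,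
   LimitHypothesisAt e₀ f hcpt → AutomorphyConclusionAt e₀ f hcpt` — one embedding on both sides;
   the two independent `∃ e` cannot be played against each other.
12. `layer_mono_set`: enlarging `S` weakens the hypothesis' layers, so WLOG `S ⊇ {λ} ∪ bad primes`.

## Targets (lead's stuck stubs)
`payload.stuck_stubs = []`, `targets = []` (lead cycle 0).  PICKED (2026-08-16T02:51Z):
`Lines/split-ramified-prime-sqrt6.lean`, 7 stubs — disprover's ledger (cycle 4; drefute notes
`DrefuteVacuity-…md`, `DrefuteSurvivors-…md`, `DrefuteNote-stub-*.md` next to this file):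
* Stub 1 `stub_placeOfMaximalIdeal`: TRUE (paper proof complete, provable now — positive, not the
  disprover's to land); `IsMaximal` and `3 ∈ 𝔐` both load-bearing, kernel-checked (§13, item 26).
* Stub 2 `stub_twistedPicardGaloisInput`: true on paper for EVERY `(ι, e)` (item 16 + CM twist;
  `A₄` has no index-2 subgroup ⇒ abs. irreducible on every quadratic `Γ_L`); `Separable` redundant
  given `natDegree = 4 ∧ 12 ∣ #Gal`; `∃ ρ` unconstructible here — not attackable.
* Stub 3 `stub_polarizedTwistedTower`: MISSTATED-VACUOUS as typed (guard `HasMuOrdinaryReductionAtThree`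
  empty, item 24; `guardedStub_of_vacuity'`); its CONCLUSION shape is the recommended restated
  interface — pre-audited in item 27 (honest; `±1 ∈ Sat` at inert primes, sign `+1` in the limit).
* Stub 4 `stub_baseChangeToL`: true on paper; provability gap = `k`-uniform `S_L` needs a STRONG
  (every-place) unramified base-change fact, the tree's `exists_baseChange_cyclic` is a.e. (drefute);
  `c₀ ≠ 1` and `S₀ ⊇ {v ∣ 3}` unused for truth.
* Stub 5 `stub_twoWallOrdinaryClassicality` (the heart, held by the lead): MISSTATED-VACUOUS as typed
  (item 24); after repair (Jacobian/Galois-level μ-ordinarity) its content is BCGP's "new ideas"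
  half (arXiv:2502.20645 p. 3) — two-wall ordinary Sen = Cousin for `Res_{K_λ/ℚ₃} GL₃`; TRUE under
  reciprocity whatever the hypotheses; invisible to finite models.  Anchor for the repaired domain:
  `f_BBW` (item 25).
* Stub 6 `stub_irregularDescentUntwist`: conclusion = `AutomorphyConclusionAt e` verbatim ⇒
  irrefutable short of `¬X` (item 2); `IsCMField`/`finrank`/`AbsIrr` decoration for truth.
* Stub 7 `stub_nonMuOrdinaryRemainder`: COSTUME — under curve-level vacuity it IS the crux
  (`nonMuOrdinaryRemainder_iff_of_vacuity`, item 24); `promote-stub` must wait for the re-typed D1.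
No `stub-false`: every defect is vacuity/costume (already noted on the item by the drefute seat);
the disprover's additions are the kernel-checked forms (§13) and the anchor `f_BBW`.
Previous registration `Lines/sen-kills-cousin-on-p2.lean` (6 stubs T, A, N, B, C, M; audited
cycle 3, item 21): no stub refutable; shape facts `three_dvd_of_finEquiv`,
`hasBaseChangeSatakeAt_three_of_fixed`; `χ((p)) = -p` pinned at inert `p` (item 22 (i)).
-/

set_option linter.dupNamespace false

namespace Summit.Langlands.Langlands.Cruxes.IrregularClassicality.Disproof

open Summit.Langlands.Langlands.Theses.PicardMuOrdinary
open Literature.NumberTheory.Automorphic Literature.NumberTheory.GaloisRepresentations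
open NumberField IsDedekindDomain Polynomial Filter

open scoped Classical

noncomputable section

/-- `K = ℚ(ω)`, the concrete field of the route. -/
abbrev K : Type := CyclotomicField 3 ℚ

/-- `ℤ̄ ⊂ ℂ`, the ring of all algebraic integers (as in the route file). -/
abbrev Zbar : Type := integralClosure ℤ ℂ

/-! ## §1 The crux dissected: hypothesis, conclusion, structure -/

/-- The conclusion of the crux = the conclusion of the target `PicardAutomorphy`:
`C_f` is automorphic over `K` (a cuspidal L-algebraic `π` on `GL₃(𝔸_K)` with
`Σ Satake(π, 𝔭) = e(a_𝔭(f))` for almost all `𝔭`). -/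
def AutomorphyConclusion (f : ℤ[X]) (hcpt : isCompact_glFiniteIntegralLevel 3 K) : Prop :=
  ∃ (e : K →+* ℂ) (π : CuspidalAutomorphicRepData 3 K hcpt), π.1.IsLAlgebraic ∧
    ∀ᶠ 𝔭 : HeightOneSpectrum (𝓞 K) in cofinite, ∃ α : Multiset ℂ,
      π.1.HasSatakeParamAt 𝔭 α ∧ α.sum = e (picardTrace f 𝔭)

/-- Layer `k` of the limit hypothesis for fixed `(e, 𝔐, S)`: a regular algebraic cuspidal `P`
unramified outside `S` with `N𝔭 · Σα(P, 𝔭) ≡ e(a_𝔭(f)) (mod 3^k ℤ̄_𝔐)` for `𝔭 ∉ S`. -/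
def Layer (f : ℤ[X]) (hcpt : isCompact_glFiniteIntegralLevel 3 K) (e : K →+* ℂ)
    (𝔐 : Ideal Zbar) (S : Finset (HeightOneSpectrum (𝓞 K))) (k : ℕ) : Prop :=
  ∃ P : CuspidalAutomorphicRepData 3 K hcpt, P.1.IsRegularAlgebraic ∧
    ∀ 𝔭 ∉ S, ∃ (α : Multiset ℂ) (t u : Zbar), P.1.HasSatakeParamAt 𝔭 α ∧
      (t : ℂ) = (𝔭.residueCard : ℂ) * α.sum - e (picardTrace f 𝔭) ∧ u ∉ 𝔐 ∧
      u * t ∈ Ideal.span {(3 : Zbar) ^ k}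

/-- The limit hypothesis of the crux (= the conclusion of `MuOrdinaryFamilyRT`): `ρ_C` is a
`3`-adic limit, in Frobenius traces off a finite `S`, of regular algebraic cuspidal `P_k`. -/
def LimitHypothesis (f : ℤ[X]) (hcpt : isCompact_glFiniteIntegralLevel 3 K) : Prop :=
  ∃ (e : K →+* ℂ) (𝔐 : Ideal Zbar) (S : Finset (HeightOneSpectrum (𝓞 K))),
    𝔐.IsMaximal ∧ (3 : Zbar) ∈ 𝔐 ∧ ∀ k : ℕ, Layer f hcpt e 𝔐 S k

/-- The crux, read back symbol by symbol: it is definitionally the implication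
`LimitHypothesis → AutomorphyConclusion` over generic quartics. -/
theorem irregularClassicality_iff :
    IrregularClassicality ↔
      ∀ (f : ℤ[X]) (hcpt : isCompact_glFiniteIntegralLevel 3 K), f.natDegree = 4 →
        (f.map (Int.castRingHom ℚ)).Separable → 12 ∣ Nat.card (f.map (Int.castRingHom ℚ)).Gal →
        LimitHypothesis f hcpt → AutomorphyConclusion f hcpt :=
  Iff.rfl

/-- The target, read back: `PicardAutomorphy` is `AutomorphyConclusion` over generic quartics. -/
theorem picardAutomorphy_iff :
    PicardAutomorphy ↔
      ∀ (f : ℤ[X]) (hcpt : isCompact_glFiniteIntegralLevel 3 K), f.natDegree = 4 →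
        (f.map (Int.castRingHom ℚ)).Separable → 12 ∣ Nat.card (f.map (Int.castRingHom ℚ)).Gal →
        AutomorphyConclusion f hcpt :=
  Iff.rfl

/-- **Structure.** The crux only ADDS a hypothesis to the target: `X → crux`.  Hence refuting the
crux refutes X, and every weakening of the limit hypothesis is still implied by X. -/
theorem irregularClassicality_of_picardAutomorphy (hX : PicardAutomorphy) : IrregularClassicality :=
  fun f hcpt hdeg hsep hgal _ => hX f hcpt hdeg hsep hgal

/-- The crux with the limit hypothesis dropped altogether. -/
def IrregularClassicalityWithoutLimit : Prop :=
  ∀ (f : ℤ[X]) (hcpt : isCompact_glFiniteIntegralLevel 3 K), f.natDegree = 4 →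
    (f.map (Int.castRingHom ℚ)).Separable → 12 ∣ Nat.card (f.map (Int.castRingHom ℚ)).Gal →
    AutomorphyConclusion f hcpt

/-- **Load-bearing analysis, limit hypothesis**: dropping it gives EXACTLY the target (so no
`_false_without_limit` theorem exists unless X is false). -/
theorem withoutLimit_iff_target : IrregularClassicalityWithoutLimit ↔ PicardAutomorphy :=
  Iff.rfl

/-! ## §2 Anatomy of the limit hypothesis -/

/-- A maximal ideal of `ℤ̄` above `3` exists (lying over for the integral extension `ℤ ⊆ ℤ̄`). -/
theorem exists_isMaximal_three_mem : ∃ 𝔐 : Ideal Zbar, 𝔐.IsMaximal ∧ (3 : Zbar) ∈ 𝔐 := by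
  have h3 : (Ideal.span {(3 : ℤ)}).IsMaximal :=
    PrincipalIdealRing.isMaximal_of_irreducible Int.prime_three.irreducible
  obtain ⟨Q, hQ, hQc⟩ := Ideal.exists_ideal_over_maximal_of_isIntegral (S := Zbar)
    (Ideal.span {(3 : ℤ)}) (fun x hx => by
      rw [RingHom.mem_ker] at hx
      have : (x : Zbar) = 0 := hx
      have hx0 : x = 0 := by exact_mod_cast congrArg Subtype.val this
      simp [hx0])
  refine ⟨Q, hQ, ?_⟩
  have : (3 : ℤ) ∈ Q.comap (algebraMap ℤ Zbar) := by
    rw [hQc]; exact Ideal.mem_span_singleton_self 3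
  simpa using this

/-- Layers are antitone in `k`: a deeper congruence is a shallower one. So `∀ k` in the
hypothesis may be replaced by "for infinitely many `k`". -/
theorem layer_antitone {f : ℤ[X]} {hcpt : isCompact_glFiniteIntegralLevel 3 K} {e : K →+* ℂ}
    {𝔐 : Ideal Zbar} {S : Finset (HeightOneSpectrum (𝓞 K))} {k l : ℕ} (hkl : k ≤ l)
    (h : Layer f hcpt e 𝔐 S l) : Layer f hcpt e 𝔐 S k := by
  obtain ⟨P, hP, h⟩ := h
  refine ⟨P, hP, fun 𝔭 h𝔭 => ?_⟩
  obtain ⟨α, t, u, hα, ht, hu, hut⟩ := h 𝔭 h𝔭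
  exact ⟨α, t, u, hα, ht, hu, Ideal.span_singleton_le_span_singleton.2 (pow_dvd_pow 3 hkl) hut⟩

/-- `∀ k` ↔ "for infinitely many `k`" in the limit hypothesis. -/
theorem limitHypothesis_iff_frequently (f : ℤ[X]) (hcpt : isCompact_glFiniteIntegralLevel 3 K) :
    LimitHypothesis f hcpt ↔
      ∃ (e : K →+* ℂ) (𝔐 : Ideal Zbar) (S : Finset (HeightOneSpectrum (𝓞 K))),
        𝔐.IsMaximal ∧ (3 : Zbar) ∈ 𝔐 ∧ ∀ k : ℕ, ∃ l, k ≤ l ∧ Layer f hcpt e 𝔐 S l := by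
  constructor
  · rintro ⟨e, 𝔐, S, h𝔐, h3, h⟩
    exact ⟨e, 𝔐, S, h𝔐, h3, fun k => ⟨k, le_rfl, h k⟩⟩
  · rintro ⟨e, 𝔐, S, h𝔐, h3, h⟩
    refine ⟨e, 𝔐, S, h𝔐, h3, fun k => ?_⟩
    obtain ⟨l, hkl, hl⟩ := h k
    exact layer_antitone hkl hl

/-- Layer `k` with the unit condition `u ∉ 𝔐` DROPPED. -/
def LayerWithoutUnit (f : ℤ[X]) (hcpt : isCompact_glFiniteIntegralLevel 3 K) (e : K →+* ℂ)
    (S : Finset (HeightOneSpectrum (𝓞 K))) (k : ℕ) : Prop :=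
  ∃ P : CuspidalAutomorphicRepData 3 K hcpt, P.1.IsRegularAlgebraic ∧
    ∀ 𝔭 ∉ S, ∃ (α : Multiset ℂ) (t u : Zbar), P.1.HasSatakeParamAt 𝔭 α ∧
      (t : ℂ) = (𝔭.residueCard : ℂ) * α.sum - e (picardTrace f 𝔭) ∧
      u * t ∈ Ideal.span {(3 : Zbar) ^ k}

/-- **Load-bearing analysis, unit condition**: without `u ∉ 𝔐` the tower collapses — layer `0`
(which asks only that `N𝔭·Σα - e(a_𝔭)` be an algebraic integer) gives every layer with `u = 0`.
So `u ∉ 𝔐` is exactly what turns the hypothesis into a `3`-adic congruence. -/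
theorem layerWithoutUnit_of_layer_zero {f : ℤ[X]} {hcpt : isCompact_glFiniteIntegralLevel 3 K}
    {e : K →+* ℂ} {𝔐 : Ideal Zbar} {S : Finset (HeightOneSpectrum (𝓞 K))}
    (h : Layer f hcpt e 𝔐 S 0) (k : ℕ) : LayerWithoutUnit f hcpt e S k := by
  obtain ⟨P, hP, h⟩ := h
  refine ⟨P, hP, fun 𝔭 h𝔭 => ?_⟩
  obtain ⟨α, t, -, hα, ht, -, -⟩ := h 𝔭 h𝔭
  exact ⟨α, t, 0, hα, ht, by simp⟩

/-- An EXACT regular-algebraic match: one regular algebraic cuspidal `P`, unramified outside `S`,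
with `N𝔭 · Σα(P, 𝔭) = e(a_𝔭(f))` for all `𝔭 ∉ S` (the C-normalised Frobenius trace of `r(P)`
equals the Picard trace).  On paper EMPTY for generic `f` (regular vs. `{0,0,1}` Hodge–Tate
weights); formally the natural base case of the tower. -/
def ExactRegularMatch (f : ℤ[X]) (hcpt : isCompact_glFiniteIntegralLevel 3 K) : Prop :=
  ∃ (e : K →+* ℂ) (S : Finset (HeightOneSpectrum (𝓞 K))) (P : CuspidalAutomorphicRepData 3 K hcpt),
    P.1.IsRegularAlgebraic ∧ ∀ 𝔭 ∉ S, ∃ α : Multiset ℂ, P.1.HasSatakeParamAt 𝔭 α ∧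
      (𝔭.residueCard : ℂ) * α.sum = e (picardTrace f 𝔭)

/-- An exact regular match satisfies the limit hypothesis (constant tower, `t = 0`, `u = 1`). -/
theorem limitHypothesis_of_exactRegularMatch {f : ℤ[X]} {hcpt : isCompact_glFiniteIntegralLevel 3 K}
    (h : ExactRegularMatch f hcpt) : LimitHypothesis f hcpt := by
  obtain ⟨e, S, P, hP, h⟩ := h
  obtain ⟨𝔐, h𝔐, h3⟩ := exists_isMaximal_three_mem
  refine ⟨e, 𝔐, S, h𝔐, h3, fun k => ⟨P, hP, fun 𝔭 h𝔭 => ?_⟩⟩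
  obtain ⟨α, hα, heq⟩ := h 𝔭 h𝔭
  refine ⟨α, 0, 1, hα, by simp [heq], fun h1 => h𝔐.ne_top ((Ideal.eq_top_iff_one _).2 h1), by simp⟩

/-! ## §3 Rigidity of the congruence tower: a stationary family is an exact match -/

/-- A non-zero algebraic integer divides a non-zero natural number in `ℤ̄`. -/
theorem exists_nat_ne_zero_dvd {t : Zbar} (ht : t ≠ 0) : ∃ N : ℕ, N ≠ 0 ∧ t ∣ (N : Zbar) := by
  have hint : IsIntegral ℤ t := Algebra.IsIntegral.isIntegral t
  obtain ⟨p, hmonic, hp⟩ := hint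
  obtain ⟨q, hpq, hXq⟩ := Polynomial.exists_eq_pow_rootMultiplicity_mul_and_not_dvd p hmonic.ne_zero 0
  simp only [map_zero, sub_zero] at hpq hXq
  have hq0 : q.coeff 0 ≠ 0 := fun h0 => hXq (Polynomial.X_dvd_iff.2 h0)
  have hpt : aeval t p = 0 := hp
  have hqt : aeval t q = 0 := by
    rw [hpq, map_mul, map_pow, aeval_X] at hpt
    exact (mul_eq_zero.1 hpt).resolve_left (pow_ne_zero _ ht)
  have hc : ((q.coeff 0 : ℤ) : Zbar) = t * (-(aeval t q.divX)) := by
    have h := congrArg (aeval t) (Polynomial.X_mul_divX_add q)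
    rw [map_add, map_mul, aeval_X, aeval_C, hqt, eq_intCast] at h
    linear_combination h
  refine ⟨(q.coeff 0).natAbs, Int.natAbs_ne_zero.2 hq0, ?_⟩
  have h1 : t ∣ ((q.coeff 0 : ℤ) : Zbar) := ⟨_, hc⟩
  have h2 : ((q.coeff 0 : ℤ) : Zbar) ∣ (((q.coeff 0).natAbs : ℤ) : Zbar) :=
    (Int.castRingHom Zbar).map_dvd (Int.dvd_natAbs.2 dvd_rfl)
  rw [Int.cast_natCast] at h2
  exact h1.trans h2

/-- **Rigidity.** In `ℤ̄`, with `𝔐 ∋ 3` maximal: if for every `k` some `u ∉ 𝔐` has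
`u · t ∈ (3^k)` — i.e. `v_𝔐(t) ≥ k` for all `k` — then `t = 0` (the valuation of a non-zero
algebraic integer is finite: `t ∣ N = 3^a m`, `3 ∤ m`, and layer `a + 1` forces `u m ∈ 𝔐`). -/
theorem eq_zero_of_forall_congr {𝔐 : Ideal Zbar} (h𝔐 : 𝔐.IsMaximal) (h3 : (3 : Zbar) ∈ 𝔐)
    {t : Zbar} (h : ∀ k : ℕ, ∃ u ∉ 𝔐, u * t ∈ Ideal.span {(3 : Zbar) ^ k}) : t = 0 := by
  by_contra ht
  obtain ⟨N, hN0, w, hw⟩ := exists_nat_ne_zero_dvd ht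
  obtain ⟨a, m, hm3, hNam⟩ := Nat.exists_eq_pow_mul_and_not_dvd hN0 3 (by norm_num)
  obtain ⟨u, hu, hut⟩ := h (a + 1)
  rw [Ideal.mem_span_singleton] at hut
  have h3a : (3 : Zbar) ^ (a + 1) ∣ u * (N : Zbar) := by
    rw [hw, ← mul_assoc]; exact hut.mul_right w
  rw [hNam] at h3a
  push_cast at h3a
  have h3ne : (3 : Zbar) ^ a ≠ 0 := by
    refine pow_ne_zero _ fun h0 => ?_
    have := congrArg Subtype.val h0
    norm_num at this
  have hdiv : (3 : Zbar) ∣ u * (m : Zbar) := by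
    rw [pow_succ, mul_left_comm] at h3a
    exact (mul_dvd_mul_iff_left h3ne).1 h3a
  have hmem : u * (m : Zbar) ∈ 𝔐 := by
    obtain ⟨r, hr⟩ := hdiv
    rw [hr]; exact 𝔐.mul_mem_right r h3
  rcases h𝔐.isPrime.mem_or_mem hmem with hu' | hm'
  · exact hu hu'
  · have hcop : IsCoprime (m : Zbar) (3 : Zbar) := by
      have hnat : Nat.Coprime m 3 :=
        Nat.coprime_comm.1 ((Nat.Prime.coprime_iff_not_dvd Nat.prime_three).2 hm3)
      have hz : IsCoprime (m : ℤ) (3 : ℤ) := Nat.isCoprime_iff_coprime.2 hnat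
      simpa using hz.map (Int.castRingHom Zbar)
    obtain ⟨x, y, hxy⟩ := hcop
    exact h𝔐.ne_top ((Ideal.eq_top_iff_one _).2
      (hxy ▸ 𝔐.add_mem (𝔐.mul_mem_left x hm') (𝔐.mul_mem_left y h3)))

/-- A STATIONARY limit: one `P` and, for each `𝔭 ∉ S`, one Satake witness and one `t`, serving
every depth `k` (only the unit `u` may depend on `k`).  A natural strengthening of
`LimitHypothesis` (quantifiers `∃ P ∃ α t` moved in front of `∀ k`). -/
def StationaryLimit (f : ℤ[X]) (hcpt : isCompact_glFiniteIntegralLevel 3 K) : Prop :=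
  ∃ (e : K →+* ℂ) (𝔐 : Ideal Zbar) (S : Finset (HeightOneSpectrum (𝓞 K)))
    (P : CuspidalAutomorphicRepData 3 K hcpt), 𝔐.IsMaximal ∧ (3 : Zbar) ∈ 𝔐 ∧
    P.1.IsRegularAlgebraic ∧ ∀ 𝔭 ∉ S, ∃ (α : Multiset ℂ) (t : Zbar), P.1.HasSatakeParamAt 𝔭 α ∧
      (t : ℂ) = (𝔭.residueCard : ℂ) * α.sum - e (picardTrace f 𝔭) ∧
      ∀ k : ℕ, ∃ u ∉ 𝔐, u * t ∈ Ideal.span {(3 : Zbar) ^ k}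

/-- A stationary limit is a limit. -/
theorem limitHypothesis_of_stationaryLimit {f : ℤ[X]} {hcpt : isCompact_glFiniteIntegralLevel 3 K}
    (h : StationaryLimit f hcpt) : LimitHypothesis f hcpt := by
  obtain ⟨e, 𝔐, S, P, h𝔐, h3, hP, h⟩ := h
  refine ⟨e, 𝔐, S, h𝔐, h3, fun k => ⟨P, hP, fun 𝔭 h𝔭 => ?_⟩⟩
  obtain ⟨α, t, hα, ht, hk⟩ := h 𝔭 h𝔭
  obtain ⟨u, hu, hut⟩ := hk k
  exact ⟨α, t, u, hα, ht, hu, hut⟩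

/-- **A stationary limit is an exact match** (rigidity applied prime by prime). -/
theorem exactRegularMatch_of_stationaryLimit {f : ℤ[X]} {hcpt : isCompact_glFiniteIntegralLevel 3 K}
    (h : StationaryLimit f hcpt) : ExactRegularMatch f hcpt := by
  obtain ⟨e, 𝔐, S, P, h𝔐, h3, hP, h⟩ := h
  refine ⟨e, S, P, hP, fun 𝔭 h𝔭 => ?_⟩
  obtain ⟨α, t, hα, ht, hk⟩ := h 𝔭 h𝔭
  have ht0 : t = 0 := eq_zero_of_forall_congr h𝔐 h3 hk
  subst ht0
  refine ⟨α, hα, ?_⟩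
  have : ((𝔭.residueCard : ℂ) * α.sum - e (picardTrace f 𝔭)) = 0 := by
    rw [← ht]; simp
  exact sub_eq_zero.1 this

/-! ## §4 Normalisations: `C = L` for `GL₃`, and an exact regular match gives the conclusion -/

/-- For `GL₃`, C-algebraic and L-algebraic infinity types coincide (`(3-1)/2 = 1 ∈ ℤ`).
[cite: BuzzardGee2014, Def. 3.1.1 and §5.3] -/
theorem isCAlgebraic_iff_isLAlgebraic_three {F : Type*} [Field F] (T : InfinityType F 3) :
    T.IsCAlgebraic ↔ T.IsLAlgebraic := by
  have h1 : (((3 : ℕ) : ℂ) - 1) / 2 = 1 := by norm_num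
  simp only [InfinityType.IsCAlgebraic, InfinityType.IsLAlgebraic, h1]
  refine forall_congr' fun σ => forall₂_congr fun p _ => ?_
  constructor
  · rintro ⟨k, l, hk, hl⟩
    exact ⟨k + 1, l + 1, by rw [hk]; push_cast; ring, by rw [hl]; push_cast; ring⟩
  · rintro ⟨k, l, hk, hl⟩
    exact ⟨k - 1, l - 1, by rw [hk]; push_cast; ring, by rw [hl]; push_cast; ring⟩

/-- Every regular algebraic `P` on `GL₃(𝔸_K)` is itself L-algebraic (so the hypothesis' `P_k`
already have the algebraicity type the conclusion asks of `π`; what differs is the `|det|⁻¹`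
twist of the Satake parameters and, on paper, regularity). -/
theorem isLAlgebraic_of_isRegularAlgebraic {hcpt : isCompact_glFiniteIntegralLevel 3 K}
    (P : CuspidalAutomorphicRepData 3 K hcpt) (h : P.1.IsRegularAlgebraic) : P.1.IsLAlgebraic := by
  obtain ⟨T, hT, hC, -⟩ := h
  exact ⟨T, hT, (isCAlgebraic_iff_isLAlgebraic_three T).1 hC⟩

/-- **Normalisation coherence (the route's kill criterion (6), settled positively).**  An exact
regular match yields the conclusion: `π := P ⊗ |det|_𝔸^{-1}` is cuspidal
(`exists_twist_hasInfinityType`), L-algebraic (integer twist of a C = L-algebraic type), and has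
Satake parameters `q_𝔭 · α` (`HasSatakeParamAt.of_map_mulChar_detTwist_of_cpow`), whose sum is
`N𝔭 · Σα = e(a_𝔭(f))`.  So the `N𝔭 · Σα` (C-normalised, regular `P_k`) and `Σα` (L-algebraic
`π`, summit `m = 1`) conventions of hypothesis and conclusion match exactly. -/
theorem automorphy_of_exactRegularMatch {f : ℤ[X]} {hcpt : isCompact_glFiniteIntegralLevel 3 K}
    (h : ExactRegularMatch f hcpt) : AutomorphyConclusion f hcpt := by
  obtain ⟨e, S, P, hreg, hS⟩ := h
  obtain ⟨T, hT, hC, -⟩ := hreg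
  obtain ⟨χ, π', hχ, hW, hW', hT'⟩ := P.exists_twist_hasInfinityType (-1 : ℝ) hT
  refine ⟨e, π', ⟨_, hT', ?_⟩, ?_⟩
  · intro σ p hp
    rw [InfinityType.twist_apply, Multiset.mem_map] at hp
    obtain ⟨p₀, hp₀, rfl⟩ := hp
    obtain ⟨k, l, hk, hl⟩ := hC σ p₀ hp₀
    refine ⟨k, l, ?_, ?_⟩
    · rw [ArchWeight.twist_a, hk]; push_cast; ring
    · rw [ArchWeight.twist_b, hl]; push_cast; ring
  · refine (S.eventually_cofinite_notMem).mono fun 𝔭 h𝔭 => ?_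
    obtain ⟨α, hα, heq⟩ := hS 𝔭 h𝔭
    refine ⟨_, AutomorphicRepData.HasSatakeParamAt.of_map_mulChar_detTwist_of_cpow hχ hW hW' hα, ?_⟩
    rw [Multiset.sum_map_mul_left, Multiset.map_id', ← heq]
    congr 1
    push_cast
    simp

/-- **The crux holds for stationary families** (positive partial result; evidence for provers). -/
theorem automorphy_of_stationaryLimit {f : ℤ[X]} {hcpt : isCompact_glFiniteIntegralLevel 3 K}
    (h : StationaryLimit f hcpt) : AutomorphyConclusion f hcpt :=
  automorphy_of_exactRegularMatch (exactRegularMatch_of_stationaryLimit h)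

/-- `IrregularClassicality` restricted to stationary limits is a theorem (no hypothesis on `f`
needed).  WHY THE CRUX RESISTS: the whole difficulty is the non-stationary tower, i.e. a genuine
`3`-adic limit object — and on paper every admissible tower IS non-stationary
(`NonRegularWeightBarrier`: `ExactRegularMatch f hcpt` is empty for generic `f`). -/
theorem irregularClassicality_stationary :
    ∀ (f : ℤ[X]) (hcpt : isCompact_glFiniteIntegralLevel 3 K),
      StationaryLimit f hcpt → AutomorphyConclusion f hcpt :=
  fun _ _ h => automorphy_of_stationaryLimit h

/-! ## §5 The `∃ e` of the conclusion is innocuous: WLOG a fixed embedding -/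

/-- `ℚ(ω)` has no real embedding (a real cube root of unity is `1`). [folklore] -/
theorem not_isReal (e : K →+* ℂ) : ¬ ComplexEmbedding.IsReal e := by
  haveI : IsCyclotomicExtension {3} ℚ K := CyclotomicField.isCyclotomicExtension 3 ℚ
  intro h
  have hζ := IsCyclotomicExtension.zeta_spec 3 ℚ K
  set z : ℂ := e (IsCyclotomicExtension.zeta 3 ℚ K) with hzdef
  have hz : IsPrimitiveRoot z 3 := hζ.map_of_injective e.injective
  have hreal : (starRingEnd ℂ) z = z := by
    have := RingHom.congr_fun (ComplexEmbedding.isReal_iff.1 h) (IsCyclotomicExtension.zeta 3 ℚ K)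
    rwa [ComplexEmbedding.conjugate_coe_eq] at this
  have h3 : z ^ 3 = 1 := hz.pow_eq_one
  have h1 : z ≠ 1 := hz.ne_one (by norm_num)
  have him : z.im = 0 := Complex.conj_eq_iff_im.1 hreal
  have hq : z ^ 2 + z + 1 = 0 := by
    have : (z - 1) * (z ^ 2 + z + 1) = 0 := by linear_combination h3
    exact (mul_eq_zero.1 this).resolve_left (sub_ne_zero.2 h1)
  have hzx : z = (z.re : ℂ) := Complex.ext (by simp) (by simp [him])
  rw [hzx] at hq
  have hq' : z.re ^ 2 + z.re + 1 = 0 := by exact_mod_cast hq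
  nlinarith [sq_nonneg (z.re + 1 / 2)]

/-- `ℚ(ω)` has exactly two complex embeddings: every `e` is `e₀` or `ē₀`. [folklore] -/
theorem embedding_eq_or_eq_conjugate (e e₀ : K →+* ℂ) :
    e = e₀ ∨ e = ComplexEmbedding.conjugate e₀ := by
  haveI : IsCyclotomicExtension {3} ℚ K := CyclotomicField.isCyclotomicExtension 3 ℚ
  have hcard : Fintype.card (K →+* ℂ) = 2 := by
    rw [NumberField.Embeddings.card]
    have h := IsCyclotomicExtension.Rat.finrank 3 K
    rw [Nat.totient_prime Nat.prime_three] at h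
    convert h using 2
  have hne : e₀ ≠ ComplexEmbedding.conjugate e₀ := fun h =>
    not_isReal e₀ (ComplexEmbedding.isReal_iff.2 h.symm)
  have huniv : ({e₀, ComplexEmbedding.conjugate e₀} : Finset (K →+* ℂ)) = Finset.univ :=
    Finset.eq_univ_of_card _ (by rw [Finset.card_pair hne, hcard])
  have hmem : e ∈ ({e₀, ComplexEmbedding.conjugate e₀} : Finset (K →+* ℂ)) :=
    huniv ▸ Finset.mem_univ e
  simpa [Finset.mem_insert, Finset.mem_singleton] using hmem

/-- **Conjugation transports the conclusion**: if `π` realises it for `e`, the complex conjugate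
representation `π̄` (`CuspidalAutomorphicRepData.conj`, cuspidal; Satake parameters `ᾱ`,
`HasSatakeParamAt.conj`; infinity type `T̄`, `HasInfinityType.conj`, L-algebraic with `T`)
realises it for `ē`. [folklore] -/
theorem conclusion_conj {f : ℤ[X]} {hcpt : isCompact_glFiniteIntegralLevel 3 K} {e : K →+* ℂ}
    {π : CuspidalAutomorphicRepData 3 K hcpt} (hL : π.1.IsLAlgebraic)
    (h : ∀ᶠ 𝔭 : HeightOneSpectrum (𝓞 K) in cofinite, ∃ α : Multiset ℂ,
      π.1.HasSatakeParamAt 𝔭 α ∧ α.sum = e (picardTrace f 𝔭)) :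
    π.conj.1.IsLAlgebraic ∧ ∀ᶠ 𝔭 : HeightOneSpectrum (𝓞 K) in cofinite, ∃ α : Multiset ℂ,
      π.conj.1.HasSatakeParamAt 𝔭 α ∧ α.sum = ComplexEmbedding.conjugate e (picardTrace f 𝔭) := by
  constructor
  · obtain ⟨T, hT, hLT⟩ := hL
    refine ⟨T.conjType, ?_, fun ι p hp => ?_⟩
    · rw [CuspidalAutomorphicRepData.conj_val]
      exact AutomorphicRepData.HasInfinityType.conj π.1 hT
    · rw [InfinityType.conjType_apply, Multiset.mem_map] at hp
      obtain ⟨p₀, hp₀, rfl⟩ := hp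
      obtain ⟨k, l, hk, hl⟩ := hLT ι p₀ hp₀
      exact ⟨l, k, by simp [hl], by simp [hk]⟩
  · refine h.mono fun 𝔭 h𝔭 => ?_
    obtain ⟨α, hα, hsum⟩ := h𝔭
    refine ⟨α.map (starRingEnd ℂ), ?_, ?_⟩
    · rw [CuspidalAutomorphicRepData.conj_val]
      exact AutomorphicRepData.HasSatakeParamAt.conj hα
    · rw [← map_multiset_sum, hsum, ComplexEmbedding.conjugate_coe_eq]

/-- **The `∃ e` of the conclusion may be fixed in advance**: for either embedding `e₀`,
`AutomorphyConclusion f hcpt ↔ ∃ π` (cuspidal, L-algebraic) with `Σ Satake(π,𝔭) = e₀(a_𝔭(f))`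
a.e.  So the existential over embeddings hides no convention: the two choices are exchanged by
`π ↦ π̄`, and a prover may aim at a fixed `e₀`. [folklore] -/
theorem automorphyConclusion_iff_fixed (e₀ : K →+* ℂ) (f : ℤ[X])
    (hcpt : isCompact_glFiniteIntegralLevel 3 K) :
    AutomorphyConclusion f hcpt ↔ ∃ π : CuspidalAutomorphicRepData 3 K hcpt, π.1.IsLAlgebraic ∧
      ∀ᶠ 𝔭 : HeightOneSpectrum (𝓞 K) in cofinite, ∃ α : Multiset ℂ,
        π.1.HasSatakeParamAt 𝔭 α ∧ α.sum = e₀ (picardTrace f 𝔭) := by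
  constructor
  · rintro ⟨e, π, hL, h⟩
    rcases embedding_eq_or_eq_conjugate e e₀ with rfl | rfl
    · exact ⟨π, hL, h⟩
    · obtain ⟨hL', h'⟩ := conclusion_conj hL h
      have hee : ComplexEmbedding.conjugate (ComplexEmbedding.conjugate e₀) = e₀ := star_star e₀
      rw [hee] at h'
      exact ⟨π.conj, hL', h'⟩
  · rintro ⟨π, hL, h⟩
    exact ⟨e₀, π, hL, h⟩

/-! ## §6 Monotonicity in `S` (the exceptional set may be enlarged freely) -/

/-- Enlarging `S` weakens every layer. So WLOG `S` contains the primes above `3`, the primes of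
bad reduction and any finite set a proof finds convenient. [folklore] -/
theorem layer_mono_set {f : ℤ[X]} {hcpt : isCompact_glFiniteIntegralLevel 3 K} {e : K →+* ℂ}
    {𝔐 : Ideal Zbar} {S S' : Finset (HeightOneSpectrum (𝓞 K))} (hSS' : S ⊆ S') {k : ℕ}
    (h : Layer f hcpt e 𝔐 S k) : Layer f hcpt e 𝔐 S' k := by
  obtain ⟨P, hP, h⟩ := h
  exact ⟨P, hP, fun 𝔭 h𝔭 => h 𝔭 fun h𝔭S => h𝔭 (hSS' h𝔭S)⟩

/-! ## §7 Conjugation symmetry of the limit hypothesis; the crux with ONE fixed embedding -/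

/-- Complex conjugation restricted to `ℤ̄` (conjugates of algebraic integers are algebraic
integers). -/
def conjZbar : Zbar →ₐ[ℤ] Zbar :=
  ((starRingEnd ℂ).toIntAlgHom.comp (integralClosure ℤ ℂ).val).codRestrict (integralClosure ℤ ℂ)
    fun x => (mem_integralClosure_iff ℤ ℂ).2 (((mem_integralClosure_iff ℤ ℂ).1 x.2).map (starRingEnd ℂ).toIntAlgHom)

@[simp] theorem coe_conjZbar (x : Zbar) : (conjZbar x : ℂ) = starRingEnd ℂ x := rfl

theorem conjZbar_conjZbar (x : Zbar) : conjZbar (conjZbar x) = x :=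
  Subtype.ext (by simp)

theorem conjZbar_surjective : Function.Surjective conjZbar :=
  fun x => ⟨conjZbar x, conjZbar_conjZbar x⟩

/-- The limit hypothesis with the embedding FIXED. -/
def LimitHypothesisAt (e : K →+* ℂ) (f : ℤ[X]) (hcpt : isCompact_glFiniteIntegralLevel 3 K) : Prop :=
  ∃ (𝔐 : Ideal Zbar) (S : Finset (HeightOneSpectrum (𝓞 K))),
    𝔐.IsMaximal ∧ (3 : Zbar) ∈ 𝔐 ∧ ∀ k : ℕ, Layer f hcpt e 𝔐 S k

/-- The conclusion with the embedding FIXED. -/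
def AutomorphyConclusionAt (e : K →+* ℂ) (f : ℤ[X]) (hcpt : isCompact_glFiniteIntegralLevel 3 K) :
    Prop :=
  ∃ π : CuspidalAutomorphicRepData 3 K hcpt, π.1.IsLAlgebraic ∧
    ∀ᶠ 𝔭 : HeightOneSpectrum (𝓞 K) in cofinite, ∃ α : Multiset ℂ,
      π.1.HasSatakeParamAt 𝔭 α ∧ α.sum = e (picardTrace f 𝔭)

/-- **Conjugation transports layers**: `P ↦ P̄` (regular algebraic, `IsRegularAlgebraic.conj`),
`α ↦ ᾱ`, `𝔐 ↦ 𝔐̄ = conj⁻¹ 𝔐`, `t, u ↦ t̄, ū`. [folklore] -/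
theorem layer_conj {f : ℤ[X]} {hcpt : isCompact_glFiniteIntegralLevel 3 K} {e : K →+* ℂ}
    {𝔐 : Ideal Zbar} {S : Finset (HeightOneSpectrum (𝓞 K))} {k : ℕ} (h : Layer f hcpt e 𝔐 S k) :
    Layer f hcpt (ComplexEmbedding.conjugate e) (𝔐.comap conjZbar) S k := by
  obtain ⟨P, hP, h⟩ := h
  refine ⟨P.conj, ?_, fun 𝔭 h𝔭 => ?_⟩
  · rw [CuspidalAutomorphicRepData.conj_val]
    exact AutomorphicRepData.IsRegularAlgebraic.conj P.1 hP
  · obtain ⟨α, t, u, hα, ht, hu, hut⟩ := h 𝔭 h𝔭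
    refine ⟨α.map (starRingEnd ℂ), conjZbar t, conjZbar u, ?_, ?_, ?_, ?_⟩
    · rw [CuspidalAutomorphicRepData.conj_val]
      exact AutomorphicRepData.HasSatakeParamAt.conj hα
    · rw [coe_conjZbar, ht, map_sub, map_mul, map_natCast, ← map_multiset_sum,
        ComplexEmbedding.conjugate_coe_eq]
    · rwa [Ideal.mem_comap, conjZbar_conjZbar]
    · rw [Ideal.mem_span_singleton] at hut ⊢
      obtain ⟨r, hr⟩ := hut
      exact ⟨conjZbar r, by rw [← map_mul, hr, map_mul, map_pow, map_ofNat]⟩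

/-- **The limit hypothesis is conjugation-symmetric.** [folklore] -/
theorem limitHypothesisAt_conj {e : K →+* ℂ} {f : ℤ[X]} {hcpt : isCompact_glFiniteIntegralLevel 3 K}
    (h : LimitHypothesisAt e f hcpt) : LimitHypothesisAt (ComplexEmbedding.conjugate e) f hcpt := by
  obtain ⟨𝔐, S, h𝔐, h3, h⟩ := h
  refine ⟨𝔐.comap conjZbar, S, ?_, ?_, fun k => layer_conj (h k)⟩
  · exact Ideal.comap_isMaximal_of_surjective _ conjZbar_surjective
  · rw [Ideal.mem_comap, map_ofNat]; exact h3

/-- WLOG the hypothesis' embedding is any fixed `e₀`. [folklore] -/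
theorem limitHypothesis_iff_at (e₀ : K →+* ℂ) (f : ℤ[X]) (hcpt : isCompact_glFiniteIntegralLevel 3 K) :
    LimitHypothesis f hcpt ↔ LimitHypothesisAt e₀ f hcpt := by
  constructor
  · rintro ⟨e, 𝔐, S, h𝔐, h3, h⟩
    rcases embedding_eq_or_eq_conjugate e e₀ with rfl | rfl
    · exact ⟨𝔐, S, h𝔐, h3, h⟩
    · have h' := limitHypothesisAt_conj ⟨𝔐, S, h𝔐, h3, h⟩
      rwa [show ComplexEmbedding.conjugate (ComplexEmbedding.conjugate e₀) = e₀ from star_star e₀] at h'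
  · rintro ⟨𝔐, S, h𝔐, h3, h⟩
    exact ⟨e₀, 𝔐, S, h𝔐, h3, h⟩

/-- **NORMAL FORM of the crux with a single fixed embedding on both sides**: for either `e₀`,
`IrregularClassicality ↔ ∀ generic f, LimitHypothesisAt e₀ f hcpt → AutomorphyConclusionAt e₀ f hcpt`.
Provers may work with one embedding throughout; disprovers learn that the two independent `∃ e`
of hypothesis and conclusion cannot be played against each other. [folklore] -/
theorem irregularClassicality_iff_fixed (e₀ : K →+* ℂ) :
    IrregularClassicality ↔
      ∀ (f : ℤ[X]) (hcpt : isCompact_glFiniteIntegralLevel 3 K), f.natDegree = 4 →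
        (f.map (Int.castRingHom ℚ)).Separable → 12 ∣ Nat.card (f.map (Int.castRingHom ℚ)).Gal →
        LimitHypothesisAt e₀ f hcpt → AutomorphyConclusionAt e₀ f hcpt := by
  rw [irregularClassicality_iff]
  refine forall₂_congr fun f hcpt => ?_
  refine imp_congr_right fun _ => imp_congr_right fun _ => imp_congr_right fun _ => ?_
  rw [limitHypothesis_iff_at e₀ f hcpt, automorphyConclusion_iff_fixed e₀ f hcpt]
  rfl


/-! ## §8 (cycle 2) Recurrence and finite range: Satake uniqueness makes any tower whose
EIGENSYSTEMS range over a finite set collapse to an exact match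

Cycle 1 (§3) collapsed STATIONARY towers (one `P`, one Satake witness and one `t` per `𝔭`).
Uniqueness of Satake parameters is a THEOREM of the tree
(`AutomorphicRepData.hasSatakeParamAt_unique_holds`, Flath), so much less is needed: it suffices
that ONE Satake eigensystem off `S` recurs at infinitely many depths (witnesses free to vary with
the depth), and hence — pigeonhole — that the eigensystems of the tower's members range over a
FINITE set.  So in every tower for which the crux has content the map `k ↦ (Satake(P_k, 𝔭))_{𝔭∉S}`
takes infinitely many values; on paper (Harish-Chandra finiteness, `harishChandra_finiteness_gl`,
+ strong multiplicity one) the `P_k` then have unbounded infinity type or unbounded level at `S`,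
and by Sen's continuity theorem [Sen, Invent. Math. 62 (1980); Berger–Colmez, Astérisque 319
(2008)] bounded infinity type is impossible anyway (item 9): the content of the crux is exactly
the towers of UNBOUNDED WEIGHT. -/

/-- `P` serves depth `k` of the tower `(e, 𝔐, S)` for `f`: the inner clause of `Layer` for a GIVEN
`P` (so `Layer … k ↔ ∃ P, P regular algebraic ∧ ServesLayer … P k`, `layer_iff_exists_servesLayer`). -/
def ServesLayer (f : ℤ[X]) (hcpt : isCompact_glFiniteIntegralLevel 3 K) (e : K →+* ℂ)
    (𝔐 : Ideal Zbar) (S : Finset (HeightOneSpectrum (𝓞 K)))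
    (P : CuspidalAutomorphicRepData 3 K hcpt) (k : ℕ) : Prop :=
  ∀ 𝔭 ∉ S, ∃ (α : Multiset ℂ) (t u : Zbar), P.1.HasSatakeParamAt 𝔭 α ∧
    (t : ℂ) = (𝔭.residueCard : ℂ) * α.sum - e (picardTrace f 𝔭) ∧ u ∉ 𝔐 ∧
    u * t ∈ Ideal.span {(3 : Zbar) ^ k}

theorem layer_iff_exists_servesLayer {f : ℤ[X]} {hcpt : isCompact_glFiniteIntegralLevel 3 K}
    {e : K →+* ℂ} {𝔐 : Ideal Zbar} {S : Finset (HeightOneSpectrum (𝓞 K))} {k : ℕ} :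
    Layer f hcpt e 𝔐 S k ↔
      ∃ P : CuspidalAutomorphicRepData 3 K hcpt, P.1.IsRegularAlgebraic ∧ ServesLayer f hcpt e 𝔐 S P k :=
  Iff.rfl

/-- Serving is antitone in the depth. [folklore] -/
theorem servesLayer_antitone {f : ℤ[X]} {hcpt : isCompact_glFiniteIntegralLevel 3 K} {e : K →+* ℂ}
    {𝔐 : Ideal Zbar} {S : Finset (HeightOneSpectrum (𝓞 K))} {P : CuspidalAutomorphicRepData 3 K hcpt}
    {k l : ℕ} (hkl : k ≤ l) (h : ServesLayer f hcpt e 𝔐 S P l) : ServesLayer f hcpt e 𝔐 S P k := by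
  intro 𝔭 h𝔭
  obtain ⟨α, t, u, hα, ht, hu, hut⟩ := h 𝔭 h𝔭
  exact ⟨α, t, u, hα, ht, hu, Ideal.span_singleton_le_span_singleton.2 (pow_dvd_pow 3 hkl) hut⟩

/-- ONE Satake eigensystem `A` (a Satake-parameter function off `S`) RECURS in the tower: at
infinitely many depths `l` some regular algebraic cuspidal `P` with Satake parameters `A` off `S`
serves depth `l`.  (The serving `P`, its witnesses `α, t, u`, and the datum realising the
eigensystem may all vary with `l`.) -/
def EigensystemRecurs (f : ℤ[X]) (hcpt : isCompact_glFiniteIntegralLevel 3 K) (e : K →+* ℂ)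
    (𝔐 : Ideal Zbar) (S : Finset (HeightOneSpectrum (𝓞 K)))
    (A : HeightOneSpectrum (𝓞 K) → Multiset ℂ) : Prop :=
  ∀ k : ℕ, ∃ l, k ≤ l ∧ ∃ P : CuspidalAutomorphicRepData 3 K hcpt, P.1.IsRegularAlgebraic ∧
    (∀ 𝔭 ∉ S, P.1.HasSatakeParamAt 𝔭 (A 𝔭)) ∧ ServesLayer f hcpt e 𝔐 S P l

/-- **Recurrence ⇒ exact match** (UNCONDITIONAL: Satake uniqueness is the tree's theorem
`hasSatakeParamAt_unique_holds`).  If one eigensystem `A` recurs at infinitely many depths then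
`N𝔭 · ΣA(𝔭) = e(a_𝔭(f))` for every `𝔭 ∉ S`: at each recurrence depth `l ≥ k` the layer's witness
`α` equals `A 𝔭` (uniqueness), so its `t` is the FIXED algebraic integer `t₀ = N𝔭·ΣA(𝔭) - e(a_𝔭)`
(the coercion `ℤ̄ → ℂ` is injective), whence `v_𝔐(t₀) ≥ k` for all `k` and `t₀ = 0` by rigidity
(`eq_zero_of_forall_congr`). [folklore] -/
theorem exactRegularMatch_of_eigensystemRecurs {f : ℤ[X]} {hcpt : isCompact_glFiniteIntegralLevel 3 K}
    {e : K →+* ℂ} {𝔐 : Ideal Zbar} {S : Finset (HeightOneSpectrum (𝓞 K))}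
    {A : HeightOneSpectrum (𝓞 K) → Multiset ℂ} (h𝔐 : 𝔐.IsMaximal) (h3 : (3 : Zbar) ∈ 𝔐)
    (h : EigensystemRecurs f hcpt e 𝔐 S A) : ExactRegularMatch f hcpt := by
  obtain ⟨l₀, -, P₀, hP₀, hA₀, hs₀⟩ := h 0
  refine ⟨e, S, P₀, hP₀, fun 𝔭 h𝔭 => ⟨A 𝔭, hA₀ 𝔭 h𝔭, ?_⟩⟩
  -- the fixed algebraic integer `t₀`
  obtain ⟨α₀, t₀, u₀, hα₀, ht₀, -, -⟩ := hs₀ 𝔭 h𝔭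
  have hαA : α₀ = A 𝔭 := P₀.1.hasSatakeParamAt_unique_holds hα₀ (hA₀ 𝔭 h𝔭)
  rw [hαA] at ht₀
  have hcong : ∀ k : ℕ, ∃ u ∉ 𝔐, u * t₀ ∈ Ideal.span {(3 : Zbar) ^ k} := by
    intro k
    obtain ⟨l, hkl, P, -, hA, hs⟩ := h k
    obtain ⟨α, t, u, hα, ht, hu, hut⟩ := hs 𝔭 h𝔭
    have hαA' : α = A 𝔭 := P.1.hasSatakeParamAt_unique_holds hα (hA 𝔭 h𝔭)
    rw [hαA'] at ht
    have htt : t = t₀ := Subtype.ext (by rw [ht, ht₀])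
    rw [htt] at hut
    exact ⟨u, hu, Ideal.span_singleton_le_span_singleton.2 (pow_dvd_pow 3 hkl) hut⟩
  have ht00 : t₀ = 0 := eq_zero_of_forall_congr h𝔐 h3 hcong
  rw [ht00] at ht₀
  have : ((𝔭.residueCard : ℂ) * (A 𝔭).sum - e (picardTrace f 𝔭)) = 0 := by rw [← ht₀]; simp
  exact sub_eq_zero.1 this

/-- **The crux holds as soon as one eigensystem recurs.** [folklore] -/
theorem automorphy_of_eigensystemRecurs {f : ℤ[X]} {hcpt : isCompact_glFiniteIntegralLevel 3 K}
    {e : K →+* ℂ} {𝔐 : Ideal Zbar} {S : Finset (HeightOneSpectrum (𝓞 K))}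
    {A : HeightOneSpectrum (𝓞 K) → Multiset ℂ} (h𝔐 : 𝔐.IsMaximal) (h3 : (3 : Zbar) ∈ 𝔐)
    (h : EigensystemRecurs f hcpt e 𝔐 S A) : AutomorphyConclusion f hcpt :=
  automorphy_of_exactRegularMatch (exactRegularMatch_of_eigensystemRecurs h𝔐 h3 h)

/-- **A recurring MEMBER suffices** (sharpening of §3: only `P` is fixed; the Satake witnesses,
`t` and `u` may depend on the depth). [folklore] -/
theorem automorphy_of_recurringMember {f : ℤ[X]} {hcpt : isCompact_glFiniteIntegralLevel 3 K}
    {e : K →+* ℂ} {𝔐 : Ideal Zbar} {S : Finset (HeightOneSpectrum (𝓞 K))}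
    {P : CuspidalAutomorphicRepData 3 K hcpt} (h𝔐 : 𝔐.IsMaximal) (h3 : (3 : Zbar) ∈ 𝔐)
    (hP : P.1.IsRegularAlgebraic) (h : ∀ k : ℕ, ∃ l, k ≤ l ∧ ServesLayer f hcpt e 𝔐 S P l) :
    AutomorphyConclusion f hcpt := by
  obtain ⟨l₀, -, hs₀⟩ := h 0
  -- the eigensystem of `P` off `S`, read off the depth-`l₀` witnesses
  let A : HeightOneSpectrum (𝓞 K) → Multiset ℂ := fun 𝔭 =>
    if h𝔭 : 𝔭 ∈ S then 0 else Classical.choose (hs₀ 𝔭 h𝔭)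
  have hA : ∀ 𝔭 ∉ S, P.1.HasSatakeParamAt 𝔭 (A 𝔭) := fun 𝔭 h𝔭 => by
    obtain ⟨t, u, hα, -⟩ := Classical.choose_spec (hs₀ 𝔭 h𝔭)
    simp only [A, dif_neg h𝔭]
    exact hα
  refine automorphy_of_eigensystemRecurs (e := e) (S := S) (A := A) h𝔐 h3 ?_
  intro k
  obtain ⟨l, hkl, hs⟩ := h k
  exact ⟨l, hkl, P, hP, hA, hs⟩

/-- A tower of FINITE EIGENSYSTEM RANGE: the limit hypothesis in which, additionally, the Satake
eigensystems off `S` of the serving `P_k` range over finitely many functions `A 0, …, A (m-1)`.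
(On paper: the `P_k` range over finitely many automorphic representations up to isomorphism off
`S` — e.g. bounded infinity type AND bounded level, by Harish-Chandra finiteness.) -/
def FiniteEigensystemRange (f : ℤ[X]) (hcpt : isCompact_glFiniteIntegralLevel 3 K) : Prop :=
  ∃ (e : K →+* ℂ) (𝔐 : Ideal Zbar) (S : Finset (HeightOneSpectrum (𝓞 K))) (m : ℕ)
    (A : Fin m → HeightOneSpectrum (𝓞 K) → Multiset ℂ), 𝔐.IsMaximal ∧ (3 : Zbar) ∈ 𝔐 ∧
    ∀ k : ℕ, ∃ (i : Fin m) (P : CuspidalAutomorphicRepData 3 K hcpt), P.1.IsRegularAlgebraic ∧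
      (∀ 𝔭 ∉ S, P.1.HasSatakeParamAt 𝔭 (A i 𝔭)) ∧ ServesLayer f hcpt e 𝔐 S P k

/-- A finite-range tower is a tower (sanity: it strengthens the hypothesis, it does not change
the statement's shape). [folklore] -/
theorem limitHypothesis_of_finiteEigensystemRange {f : ℤ[X]}
    {hcpt : isCompact_glFiniteIntegralLevel 3 K} (h : FiniteEigensystemRange f hcpt) :
    LimitHypothesis f hcpt := by
  obtain ⟨e, 𝔐, S, m, A, h𝔐, h3, h⟩ := h
  refine ⟨e, 𝔐, S, h𝔐, h3, fun k => ?_⟩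
  obtain ⟨i, P, hP, -, hs⟩ := h k
  exact ⟨P, hP, hs⟩

/-- A stationary tower (§3) has finite eigensystem range (`m = 1`). [folklore] -/
theorem finiteEigensystemRange_of_stationaryLimit {f : ℤ[X]}
    {hcpt : isCompact_glFiniteIntegralLevel 3 K} (h : StationaryLimit f hcpt) :
    FiniteEigensystemRange f hcpt := by
  obtain ⟨e, 𝔐, S, P, h𝔐, h3, hP, h⟩ := h
  let A : HeightOneSpectrum (𝓞 K) → Multiset ℂ := fun 𝔭 =>
    if h𝔭 : 𝔭 ∈ S then 0 else Classical.choose (h 𝔭 h𝔭)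
  refine ⟨e, 𝔐, S, 1, fun _ => A, h𝔐, h3, fun k => ⟨0, P, hP, fun 𝔭 h𝔭 => ?_, fun 𝔭 h𝔭 => ?_⟩⟩
  · obtain ⟨t, hα, -⟩ := Classical.choose_spec (h 𝔭 h𝔭)
    simp only [A, dif_neg h𝔭]
    exact hα
  · obtain ⟨α, t, hα, ht, hk⟩ := h 𝔭 h𝔭
    obtain ⟨u, hu, hut⟩ := hk k
    exact ⟨α, t, u, hα, ht, hu, hut⟩

/-- **Pigeonhole: a finite-range tower has a recurring eigensystem, hence an exact match.**
[folklore] -/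
theorem exactRegularMatch_of_finiteEigensystemRange {f : ℤ[X]}
    {hcpt : isCompact_glFiniteIntegralLevel 3 K} (h : FiniteEigensystemRange f hcpt) :
    ExactRegularMatch f hcpt := by
  obtain ⟨e, 𝔐, S, m, A, h𝔐, h3, h⟩ := h
  choose i hi using h
  -- some index is hit at infinitely many depths
  obtain ⟨j, hj⟩ := Finite.exists_infinite_fiber i
  have hinf : (i ⁻¹' {j}).Infinite := Set.infinite_coe_iff.1 hj
  refine exactRegularMatch_of_eigensystemRecurs (e := e) (S := S) (A := A j) h𝔐 h3 ?_
  intro k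
  obtain ⟨l, hl, hkl⟩ := hinf.exists_gt k
  obtain ⟨P, hP, hA, hs⟩ := hi l
  have hlj : i l = j := hl
  exact ⟨l, hkl.le, P, hP, fun 𝔭 h𝔭 => hlj ▸ hA 𝔭 h𝔭, hs⟩

/-- **`IrregularClassicality` HOLDS for every tower of finite eigensystem range** — no
hypothesis on `f`.  Contrapositively: a tower on which the crux has content runs through
infinitely many distinct eigensystems (on paper: unbounded weight, item 9 / §8 docstring).
[folklore] -/
theorem irregularClassicality_finiteRange :
    ∀ (f : ℤ[X]) (hcpt : isCompact_glFiniteIntegralLevel 3 K),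
      FiniteEigensystemRange f hcpt → AutomorphyConclusion f hcpt :=
  fun _ _ h => automorphy_of_exactRegularMatch (exactRegularMatch_of_finiteEigensystemRange h)

/-! ## §9 (cycle 2) Load-bearing analysis of `3 ∈ 𝔐`: delete it and the hypothesis forgets `f`

The only place where the curve enters the limit hypothesis is `t = N𝔭·Σα - e(a_𝔭(f))` — and
`e(a_𝔭(f))` is itself an algebraic integer.  So depth `0` (where `(3^0) = ℤ̄` makes the unit
condition vacuous) says only "`N𝔭·Σα(P, 𝔭)` is an algebraic integer for `𝔭 ∉ S`", an `f`-free
integrality property of `P`; and if `3 ∉ 𝔐` (allowed once `3 ∈ 𝔐` is deleted: take `𝔐` above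
`2`) then `u := 3^k ∉ 𝔐` serves every depth, so the whole tower is its depth `0`.  Consequently
the crux with `3 ∈ 𝔐` deleted is LITERALLY "(some regular algebraic cuspidal `P` on `GL₃/ℚ(ω)`
has integral Hecke traces off a finite set) → X": the conjunct `3 ∈ 𝔐` carries the entire
`3`-adic (indeed the entire `f`-dependent) content of the hypothesis.  On paper its antecedent is
true (integrality of Hecke eigenvalues on cohomology), so this variant is X itself — again no
`_false_without_` theorem short of `¬X`, but now for a transparent reason. -/

/-- `e(a_𝔭(f))` is an algebraic integer (image of an element of `𝓞 K`). [folklore] -/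
theorem isIntegral_embedding_picardTrace (e : K →+* ℂ) (f : ℤ[X]) (𝔭 : HeightOneSpectrum (𝓞 K)) :
    IsIntegral ℤ (e (picardTrace f 𝔭)) :=
  map_isIntegral_int e (RingOfIntegers.isIntegral_coe (picardTrace f 𝔭))

/-- Hence `e(a_𝔭(f)) ∈ ℤ̄`: there is `a : ℤ̄` with `(a : ℂ) = e(a_𝔭(f))`. [folklore] -/
theorem exists_zbar_coe_eq_picardTrace (e : K →+* ℂ) (f : ℤ[X]) (𝔭 : HeightOneSpectrum (𝓞 K)) :
    ∃ a : Zbar, (a : ℂ) = e (picardTrace f 𝔭) :=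
  ⟨⟨e (picardTrace f 𝔭), (mem_integralClosure_iff ℤ ℂ).2 (isIntegral_embedding_picardTrace e f 𝔭)⟩,
    rfl⟩

/-- An `f`-FREE property of a level datum: some regular algebraic cuspidal `P` on `GL₃(𝔸_K)` is
unramified outside `S` with `N𝔭 · Σ Satake(P, 𝔭)` an algebraic integer for every `𝔭 ∉ S`
(on paper: every regular algebraic cuspidal `P` qualifies, with `S` its ramification set). -/
def IntegralRegularCuspidal (hcpt : isCompact_glFiniteIntegralLevel 3 K)
    (S : Finset (HeightOneSpectrum (𝓞 K))) : Prop :=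
  ∃ P : CuspidalAutomorphicRepData 3 K hcpt, P.1.IsRegularAlgebraic ∧
    ∀ 𝔭 ∉ S, ∃ α : Multiset ℂ, P.1.HasSatakeParamAt 𝔭 α ∧
      IsIntegral ℤ ((𝔭.residueCard : ℂ) * α.sum)

/-- **Depth `0` forgets `f`**: for `𝔐 ≠ ⊤`, `Layer f hcpt e 𝔐 S 0 ↔ IntegralRegularCuspidal hcpt S`.
[folklore] -/
theorem layer_zero_iff {f : ℤ[X]} {hcpt : isCompact_glFiniteIntegralLevel 3 K} {e : K →+* ℂ}
    {𝔐 : Ideal Zbar} {S : Finset (HeightOneSpectrum (𝓞 K))} (h𝔐 : 𝔐 ≠ ⊤) :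
    Layer f hcpt e 𝔐 S 0 ↔ IntegralRegularCuspidal hcpt S := by
  constructor
  · rintro ⟨P, hP, h⟩
    refine ⟨P, hP, fun 𝔭 h𝔭 => ?_⟩
    obtain ⟨α, t, u, hα, ht, -, -⟩ := h 𝔭 h𝔭
    refine ⟨α, hα, ?_⟩
    have heq : (𝔭.residueCard : ℂ) * α.sum = t + e (picardTrace f 𝔭) := by rw [ht]; ring
    rw [heq]
    exact ((mem_integralClosure_iff ℤ ℂ).1 t.2).add (isIntegral_embedding_picardTrace e f 𝔭)
  · rintro ⟨P, hP, h⟩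
    obtain ⟨w, hw⟩ : ∃ w : Zbar, w ∉ 𝔐 := by
      by_contra hall
      exact h𝔐 ((Ideal.eq_top_iff_one _).2 (not_not.1 (not_exists.1 hall 1)))
    refine ⟨P, hP, fun 𝔭 h𝔭 => ?_⟩
    obtain ⟨α, hα, hint⟩ := h 𝔭 h𝔭
    obtain ⟨a, ha⟩ := exists_zbar_coe_eq_picardTrace e f 𝔭
    refine ⟨α, ⟨(𝔭.residueCard : ℂ) * α.sum, (mem_integralClosure_iff ℤ ℂ).2 hint⟩ - a, w, hα,
      ?_, hw, by simp⟩
    push_cast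
    rw [ha]

/-- **If `3^k ∉ 𝔐`, depth `k` is depth `0`** (`u := 3^k` serves). [folklore] -/
theorem layer_iff_layer_zero_of_pow_not_mem {f : ℤ[X]} {hcpt : isCompact_glFiniteIntegralLevel 3 K}
    {e : K →+* ℂ} {𝔐 : Ideal Zbar} {S : Finset (HeightOneSpectrum (𝓞 K))} {k : ℕ}
    (hk : (3 : Zbar) ^ k ∉ 𝔐) : Layer f hcpt e 𝔐 S k ↔ Layer f hcpt e 𝔐 S 0 := by
  refine ⟨layer_antitone (Nat.zero_le k), ?_⟩
  rintro ⟨P, hP, h⟩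
  refine ⟨P, hP, fun 𝔭 h𝔭 => ?_⟩
  obtain ⟨α, t, -, hα, ht, -, -⟩ := h 𝔭 h𝔭
  exact ⟨α, t, (3 : Zbar) ^ k, hα, ht, hk, Ideal.mul_mem_right t _ (Ideal.mem_span_singleton_self _)⟩

/-- For a PRIME `𝔐 ∌ 3` every depth is depth `0`. [folklore] -/
theorem layer_iff_layer_zero_of_three_not_mem {f : ℤ[X]} {hcpt : isCompact_glFiniteIntegralLevel 3 K}
    {e : K →+* ℂ} {𝔐 : Ideal Zbar} {S : Finset (HeightOneSpectrum (𝓞 K))} (h𝔐 : 𝔐.IsPrime)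
    (h3 : (3 : Zbar) ∉ 𝔐) (k : ℕ) : Layer f hcpt e 𝔐 S k ↔ Layer f hcpt e 𝔐 S 0 :=
  layer_iff_layer_zero_of_pow_not_mem fun hk => h3 (h𝔐.mem_of_pow_mem k hk)

/-- A maximal ideal of `ℤ̄` above `2` exists; it does not contain `3`. [folklore] -/
theorem exists_isMaximal_two_mem_three_not_mem :
    ∃ 𝔐 : Ideal Zbar, 𝔐.IsMaximal ∧ (2 : Zbar) ∈ 𝔐 ∧ (3 : Zbar) ∉ 𝔐 := by
  have h2 : (Ideal.span {(2 : ℤ)}).IsMaximal :=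
    PrincipalIdealRing.isMaximal_of_irreducible Int.prime_two.irreducible
  obtain ⟨Q, hQ, hQc⟩ := Ideal.exists_ideal_over_maximal_of_isIntegral (S := Zbar)
    (Ideal.span {(2 : ℤ)}) (fun x hx => by
      rw [RingHom.mem_ker] at hx
      have : (x : Zbar) = 0 := hx
      have hx0 : x = 0 := by exact_mod_cast congrArg Subtype.val this
      simp [hx0])
  refine ⟨Q, hQ, ?_, fun h3 => ?_⟩
  · have : (2 : ℤ) ∈ Q.comap (algebraMap ℤ Zbar) := by
      rw [hQc]; exact Ideal.mem_span_singleton_self 2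
    simpa using this
  · have h2Q : (2 : Zbar) ∈ Q := by
      have : (2 : ℤ) ∈ Q.comap (algebraMap ℤ Zbar) := by
        rw [hQc]; exact Ideal.mem_span_singleton_self 2
      simpa using this
    have h1 : (1 : Zbar) = 3 - 2 := by norm_num
    exact hQ.ne_top ((Ideal.eq_top_iff_one _).2 (h1 ▸ Q.sub_mem h3 h2Q))

/-- `ℚ(ω)` has a complex embedding. [folklore] -/
theorem nonempty_embedding : Nonempty (K →+* ℂ) := by
  rw [← Fintype.card_pos_iff, NumberField.Embeddings.card]
  exact Module.finrank_pos

/-- The limit hypothesis with the conjunct `3 ∈ 𝔐` DELETED. -/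
def LimitHypothesisWithout3 (f : ℤ[X]) (hcpt : isCompact_glFiniteIntegralLevel 3 K) : Prop :=
  ∃ (e : K →+* ℂ) (𝔐 : Ideal Zbar) (S : Finset (HeightOneSpectrum (𝓞 K))),
    𝔐.IsMaximal ∧ ∀ k : ℕ, Layer f hcpt e 𝔐 S k

/-- **Without `3 ∈ 𝔐` the hypothesis forgets `f` (and `e`, and `𝔐`)**: it is equivalent to the
`f`-free integrality property `∃ S, IntegralRegularCuspidal hcpt S`. [folklore] -/
theorem limitHypothesisWithout3_iff (f : ℤ[X]) (hcpt : isCompact_glFiniteIntegralLevel 3 K) :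
    LimitHypothesisWithout3 f hcpt ↔ ∃ S, IntegralRegularCuspidal hcpt S := by
  constructor
  · rintro ⟨e, 𝔐, S, h𝔐, h⟩
    exact ⟨S, (layer_zero_iff h𝔐.ne_top).1 (h 0)⟩
  · rintro ⟨S, hS⟩
    obtain ⟨𝔐, h𝔐, -, h3⟩ := exists_isMaximal_two_mem_three_not_mem
    obtain ⟨e⟩ := nonempty_embedding
    refine ⟨e, 𝔐, S, h𝔐, fun k => ?_⟩
    rw [layer_iff_layer_zero_of_three_not_mem h𝔐.isPrime h3 k, layer_zero_iff h𝔐.ne_top]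
    exact hS

/-- The crux with `3 ∈ 𝔐` deleted from its hypothesis. -/
def IrregularClassicalityWithout3 : Prop :=
  ∀ (f : ℤ[X]) (hcpt : isCompact_glFiniteIntegralLevel 3 K), f.natDegree = 4 →
    (f.map (Int.castRingHom ℚ)).Separable → 12 ∣ Nat.card (f.map (Int.castRingHom ℚ)).Gal →
    LimitHypothesisWithout3 f hcpt → AutomorphyConclusion f hcpt

/-- **Load-bearing analysis of `3 ∈ 𝔐`.**  With it deleted the crux is LITERALLY "an `f`-free
integrality fact about `GL₃/ℚ(ω)` implies X": `IrregularClassicalityWithout3 ↔ ∀ hcpt,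
(∃ S, IntegralRegularCuspidal hcpt S) → (X at level datum hcpt)`.  So `3 ∈ 𝔐` is the entire
coupling between the hypothesis and the curve; on paper the antecedent holds (integrality of
Hecke eigenvalues of cohomological cusp forms on `GL₃/K`, e.g. base changes of symmetric squares),
so the variant is X itself and admits no `_false_without_` theorem short of `¬X`. [folklore] -/
theorem irregularClassicalityWithout3_iff :
    IrregularClassicalityWithout3 ↔
      ∀ hcpt : isCompact_glFiniteIntegralLevel 3 K, (∃ S, IntegralRegularCuspidal hcpt S) →
        ∀ f : ℤ[X], f.natDegree = 4 → (f.map (Int.castRingHom ℚ)).Separable →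
          12 ∣ Nat.card (f.map (Int.castRingHom ℚ)).Gal → AutomorphyConclusion f hcpt := by
  constructor
  · intro h hcpt hI f hdeg hsep hgal
    exact h f hcpt hdeg hsep hgal ((limitHypothesisWithout3_iff f hcpt).2 hI)
  · intro h f hcpt hdeg hsep hgal hL
    exact h hcpt ((limitHypothesisWithout3_iff f hcpt).1 hL) f hdeg hsep hgal

/-- The variant sits between the target and the crux: `X → Without3 → crux`. [folklore] -/
theorem irregularClassicalityWithout3_of_picardAutomorphy (hX : PicardAutomorphy) :
    IrregularClassicalityWithout3 :=
  fun f hcpt hdeg hsep hgal _ => hX f hcpt hdeg hsep hgal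

theorem irregularClassicality_of_without3 (h : IrregularClassicalityWithout3) : IrregularClassicality := by
  rw [irregularClassicality_iff]
  intro f hcpt hdeg hsep hgal hL
  obtain ⟨e, 𝔐, S, h𝔐, -, hk⟩ := hL
  exact h f hcpt hdeg hsep hgal ⟨e, 𝔐, S, h𝔐, hk⟩

/-- With `3 ∈ 𝔐` present, depth `0` is still the `f`-free integrality property, and the genuine
hypothesis implies it: every admissible tower lives over an "integral" level datum. [folklore] -/
theorem integralRegularCuspidal_of_limitHypothesis {f : ℤ[X]}
    {hcpt : isCompact_glFiniteIntegralLevel 3 K} (h : LimitHypothesis f hcpt) :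
    ∃ S, IntegralRegularCuspidal hcpt S := by
  obtain ⟨e, 𝔐, S, h𝔐, -, h⟩ := h
  exact ⟨S, (layer_zero_iff h𝔐.ne_top).1 (h 0)⟩

/-! ## §10 (cycle 2) The remaining conjuncts: `IsRegularAlgebraic` and `IsMaximal`

* `IsRegularAlgebraic` DELETED from the `P_k`: the hypothesis gets weaker, so the variant again
  sits between X and the crux (`X → WithoutRegular → crux`, below); on paper the weakened
  hypothesis is met by the STATIONARY tower `P_k := π_C ⊗ |det|` (L-algebraic of the irregular
  type, Satake `α/N𝔭`) as soon as `C` is automorphic, so it is X in disguise.  Regularity is what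
  makes the hypothesis the OUTPUT of an `R = T` machine (sibling crux 13757) and what forces every
  admissible tower to be non-stationary (`NonRegularWeightBarrier`) — load-bearing for the route,
  not for the truth value.
* `IsMaximal` weakened to "proper ideal containing `3`" (e.g. `𝔐 = 3ℤ̄`): `u ∉ 3ℤ̄` then only says
  that `u` is a unit at SOME place above `3` (a place free to depend on `𝔭` and `k`), so the
  congruence `N𝔭·Σα ≡ e(a_𝔭) (mod 3^k)` would be allowed to hold at a `𝔭`-dependent `3`-adic
  place — no longer a congruence of pseudo-characters at one place.  The maximality conjunct is
  thus what pins ONE `3`-adic place uniformly in `(k, 𝔭)`; the weakened variant is a genuinely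
  stronger statement than the crux whose truth on paper is unclear, and (like everything here)
  it has no finite model in the tree.  Recorded, not pursued. -/

/-- Depth `k` with `IsRegularAlgebraic` deleted. -/
def LayerAnyType (f : ℤ[X]) (hcpt : isCompact_glFiniteIntegralLevel 3 K) (e : K →+* ℂ)
    (𝔐 : Ideal Zbar) (S : Finset (HeightOneSpectrum (𝓞 K))) (k : ℕ) : Prop :=
  ∃ P : CuspidalAutomorphicRepData 3 K hcpt, ServesLayer f hcpt e 𝔐 S P k

/-- The crux with `IsRegularAlgebraic` deleted from its hypothesis. -/
def IrregularClassicalityAnyType : Prop :=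
  ∀ (f : ℤ[X]) (hcpt : isCompact_glFiniteIntegralLevel 3 K), f.natDegree = 4 →
    (f.map (Int.castRingHom ℚ)).Separable → 12 ∣ Nat.card (f.map (Int.castRingHom ℚ)).Gal →
    (∃ (e : K →+* ℂ) (𝔐 : Ideal Zbar) (S : Finset (HeightOneSpectrum (𝓞 K))),
      𝔐.IsMaximal ∧ (3 : Zbar) ∈ 𝔐 ∧ ∀ k : ℕ, LayerAnyType f hcpt e 𝔐 S k) →
    AutomorphyConclusion f hcpt

theorem irregularClassicalityAnyType_of_picardAutomorphy (hX : PicardAutomorphy) :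
    IrregularClassicalityAnyType :=
  fun f hcpt hdeg hsep hgal _ => hX f hcpt hdeg hsep hgal

/-- `X → AnyType → crux`: deleting regularity gives no `_false_without_` theorem either. [folklore] -/
theorem irregularClassicality_of_anyType (h : IrregularClassicalityAnyType) : IrregularClassicality := by
  rw [irregularClassicality_iff]
  intro f hcpt hdeg hsep hgal hL
  obtain ⟨e, 𝔐, S, h𝔐, h3, hk⟩ := hL
  refine h f hcpt hdeg hsep hgal ⟨e, 𝔐, S, h𝔐, h3, fun k => ?_⟩
  obtain ⟨P, -, hs⟩ := hk k
  exact ⟨P, hs⟩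


/-! ## §11 (cycle 2) One normal form for the lead: fixed embedding, large `S`, cofinal depths

Combining §2 (`∀ k` ↔ cofinally many `k`), §6 (enlarge `S`) and §7 (fix the embedding): to prove
the crux it suffices — and is necessary — to treat, for each generic `f`, ONE embedding `e₀`,
every maximal `𝔐 ∋ 3`, every `S` containing any prescribed finite set `S₀ f` (e.g. the primes
above `3 · disc f · lead f`), and towers known only at cofinally many depths. -/

/-- **Normal form of `IrregularClassicality`.**  For any fixed embedding `e₀` and any assignment
`S₀` of a finite set of places to each quartic:
`IrregularClassicality ↔ ∀ generic f, ∀ 𝔐 maximal ∋ 3, ∀ S ⊇ S₀ f,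
(∀ k, ∃ l ≥ k, Layer f hcpt e₀ 𝔐 S l) → AutomorphyConclusionAt e₀ f hcpt`. [folklore] -/
theorem irregularClassicality_iff_normalForm (e₀ : K →+* ℂ)
    (S₀ : ℤ[X] → Finset (HeightOneSpectrum (𝓞 K))) :
    IrregularClassicality ↔
      ∀ (f : ℤ[X]) (hcpt : isCompact_glFiniteIntegralLevel 3 K), f.natDegree = 4 →
        (f.map (Int.castRingHom ℚ)).Separable → 12 ∣ Nat.card (f.map (Int.castRingHom ℚ)).Gal →
        ∀ (𝔐 : Ideal Zbar) (S : Finset (HeightOneSpectrum (𝓞 K))), 𝔐.IsMaximal → (3 : Zbar) ∈ 𝔐 →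
          S₀ f ⊆ S → (∀ k : ℕ, ∃ l, k ≤ l ∧ Layer f hcpt e₀ 𝔐 S l) →
          AutomorphyConclusionAt e₀ f hcpt := by
  rw [irregularClassicality_iff_fixed e₀]
  constructor
  · intro h f hcpt hdeg hsep hgal 𝔐 S h𝔐 h3 _ hk
    refine h f hcpt hdeg hsep hgal ⟨𝔐, S, h𝔐, h3, fun k => ?_⟩
    obtain ⟨l, hkl, hl⟩ := hk k
    exact layer_antitone hkl hl
  · intro h f hcpt hdeg hsep hgal hL
    obtain ⟨𝔐, S, h𝔐, h3, hk⟩ := hL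
    refine h f hcpt hdeg hsep hgal 𝔐 (S ∪ S₀ f) h𝔐 h3 Finset.subset_union_right fun k => ?_
    exact ⟨k, le_rfl, layer_mono_set Finset.subset_union_left (hk k)⟩

/-- The same normal form with, in addition, the finite-eigensystem-range case REMOVED from the
obligations: by §8 the lead may assume the tower runs through infinitely many eigensystems, i.e.
that NO Satake function off `S` recurs (here phrased as: every recurring eigensystem already
yields the conclusion, which `automorphy_of_eigensystemRecurs` discharges). [folklore] -/
theorem irregularClassicality_iff_nonrecurring (e₀ : K →+* ℂ) :
    IrregularClassicality ↔
      ∀ (f : ℤ[X]) (hcpt : isCompact_glFiniteIntegralLevel 3 K), f.natDegree = 4 →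
        (f.map (Int.castRingHom ℚ)).Separable → 12 ∣ Nat.card (f.map (Int.castRingHom ℚ)).Gal →
        ∀ (𝔐 : Ideal Zbar) (S : Finset (HeightOneSpectrum (𝓞 K))), 𝔐.IsMaximal → (3 : Zbar) ∈ 𝔐 →
          (∀ A : HeightOneSpectrum (𝓞 K) → Multiset ℂ, ¬ EigensystemRecurs f hcpt e₀ 𝔐 S A) →
          (∀ k : ℕ, Layer f hcpt e₀ 𝔐 S k) → AutomorphyConclusionAt e₀ f hcpt := by
  rw [irregularClassicality_iff_fixed e₀]
  constructor
  · intro h f hcpt hdeg hsep hgal 𝔐 S h𝔐 h3 _ hk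
    exact h f hcpt hdeg hsep hgal ⟨𝔐, S, h𝔐, h3, hk⟩
  · intro h f hcpt hdeg hsep hgal hL
    obtain ⟨𝔐, S, h𝔐, h3, hk⟩ := hL
    by_cases hrec : ∃ A : HeightOneSpectrum (𝓞 K) → Multiset ℂ, EigensystemRecurs f hcpt e₀ 𝔐 S A
    · obtain ⟨A, hA⟩ := hrec
      exact (automorphyConclusion_iff_fixed e₀ f hcpt).1 (automorphy_of_eigensystemRecurs h𝔐 h3 hA)
    · exact h f hcpt hdeg hsep hgal 𝔐 S h𝔐 h3 (not_exists.1 hrec) hk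

/-! ## §12 (cycle 3) The registered line's unitary interface at conjugation-fixed places, and the
INERT SUPERSINGULAR FACTOR of a Picard curve

Context: the registered skeleton `Lines/sen-kills-cousin-on-p2.lean` (and both sibling lines)
replaces the typed `GL₃` tower by a `χ`-TWISTED UNITARY tower (Stub T `stub_twistedUnitaryTower`,
consumed by the lever Stub B): cuspidal `π_k` on Mok's `U_{K/ℚ}(3)` with base-change Satake
parameters `β` off `S` and `χ(ϖ_𝔭)·Σβ(π_k,𝔭) ≡ e₀(a_𝔭 f) (mod 3^k)`, `χ` a FIXED algebraic Hecke
character.  Two cheap facts about that interface, one formal and one arithmetic.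

(a) FORMAL (`hasBaseChangeSatakeAt_three_of_fixed`): at a place `w` of `K` FIXED by `c` — the inert
primes `(p)`, `p ≡ 2 (mod 3)`, and `λ` — the Literature predicate `UnitaryGroup.IsBaseChangeParam`
pins the parameter to `(b, 1, b⁻¹)`: the base-change Satake multiset CONTAINS `1` and sums to
`b + 1 + b⁻¹`.  So at every inert `𝔭 ∉ S` the stub's congruence reads
`χ((p))·(b_k + 1 + b_k⁻¹) ≡ a_𝔭(f) (mod 3^k)`.  Prime by prime this is solvable for ANY value of
`χ((p))` (`b_k ∈ ℂ` is free), so no finite-model kill; but globally (Chebotarev + Brauer–Nesbitt for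
the Galois representations of the regular base changes `P_k`, which are conjugate self-dual on the
nose) it forces, in the `3`-adic limit, `χ((p))` to be an EIGENVALUE of `Frob_𝔭` on `V_e` for all but
finitely many inert `𝔭` — the finite-order part of `χ` is pinned at the inert primes, it is not
"absorbed by `∃ χ`" freely.  Which eigenvalue?  Answer (b).

(b) ARITHMETIC — the inert supersingular factor (paper lemma, numerically certified; shadow lemmas
`root_neg_p_of_closure_of_det` and `det_fromBlocks_zero_diag_three` below).  Let `𝔭 = (p)` be an
inert prime of good reduction for `C : y³ = f(x)` and `F = Frob_𝔭 = Frob_p²` (geometric).  On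
`H¹(C) = V_e ⊕ V_ē` the `𝔽_p`-Frobenius SWAPS the two `ω`-eigenparts (`Frob_p ∘ u = u² ∘ Frob_p`), so
`Frob_p = (0 A; B 0)` and `F|V_e = AB`, `F|V_ē = BA` have the same characteristic polynomial
`P_e(T) ∈ ℤ[T]` (whence `a_𝔭(f) ∈ ℤ`, observed in cycle 1 item 10), and
`det(F | V_e) = det A · det B = -det(Frob_p | H¹) = -p³` (block anti-diagonal determinant with blocks
of ODD size `3`: `det_fromBlocks_zero_diag_three`; `det(Frob_p | H¹) = p^g`).  The Weil pairing
(`V_ē ≅ V_e^∨(-1)`) makes the eigenvalue multiset `{γ₁, γ₂, γ₃}` of `F|V_e` closed under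
`γ ↦ p²/γ`; closure + `det = -p³` give `P_e(-p) = 0` (`root_neg_p_of_closure_of_det`, pure algebra):
**`-p` is an eigenvalue of `Frob_𝔭` on `V_e` at EVERY inert good prime, for EVERY Picard curve**,
`P_e(T) = (T + p)(T² - (a_𝔭 + p)T + p²)`, equivalently `T² + p` divides the `L`-polynomial of `C/𝔽_p`
(a supersingular elliptic isogeny factor of `J(C) ⊗ 𝔽_p` at every inert `p`), equivalently
`tr(F² | V_e) = a_𝔭(a_𝔭 + 2p)`, and (Weil) `-3p ≤ a_𝔭(f) ≤ p` — an ASYMMETRIC bound.  Certified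
numerically (folder `compute/inert_frob.py`, output `inert_frob_29.out` attached as evidence): for 13
quartics (S₄, A₄, non-monic, a cubic twist, `3 ∣ disc`, the CM anchor `f₆₇`) and the inert
`p ∈ {5, 11, 17, 23, 29}`, all 62 good-reduction cases satisfy `tr(F²|V_e) = a_𝔭(a_𝔭 + 2p)` exactly
(57 with `a_𝔭 ≠ 0`, where the recovered sign `(a_𝔭² - s₂)/(2pa_𝔭)` is `-1` every time, never `+1`;
5 with `a_𝔭 = 0 = s₂`, among them `f₆₇` at every inert `p`, as befits an induced `V_e`), and
`-3p ≤ a_𝔭 ≤ p` throughout (e.g. `a_𝔭 = 21 ≤ 29`, `-67 ≥ -87`); independently, brute-force point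
counts give `L_{C/𝔽₅}(T) = (1 + 5T²)(1 + 7T² + 25T⁴)` for `y³ = x⁴ + x + 1` (`compute/brute_check.py`).
CONSEQUENCES FOR THE LEAD. (i) In Stub T/B one may (and generically must) take `χ((p)) = -p` at every
inert `p ∉ S`: the canonical `χ` is the Grössencharacter of a CM elliptic curve `y² = x³ + D` over `ℚ`
(`a_p = 0`, `Frob_p² = -p` at inert `p`; conductor supported at `λ` for `D = 1, 16`), the residual
freedom being characters `μ` with `μ^c = μ⁻¹` and `μ((p)) = 1` at almost all inert `p` (e.g.
`μ₀ ∘ N_{K/ℚ}`, `μ₀` quadratic); `χ χ^c = ‖·‖∓¹` (weight `∓1`) is forced by the polarizations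
(`ρ_C^c ≅ ρ_C^∨ ε⁻¹` versus `r(P_k)^c ≅ r(P_k)^∨ ε⁻²`), as the line cards say.  (ii) The unitary
avatar `ρ_C ⊗ χ̃⁻¹ ⊗ ε⁻¹` has `Frob_𝔭`-eigenvalue EXACTLY `p² = N𝔭` at every inert `𝔭`, matching the
rigid middle parameter `1` of (a) on the nose — the corrected interface passes this consistency
test, which the discarded `IsConjSelfDualAE` restate fails (parity, line cards; re-derived: a
conjugate-self-dual-on-the-nose `P_k ≡ ρ_C (mod 3^k)` forces `(N𝔭 - 1)·a_𝔭̄ ≡ 0 (mod 3^k)` off `S`,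
false for large `k` at split `𝔭` with `a_𝔭̄` a `λ`-unit — for `A₄`-quartics whose cyclic cubic
resolvent field is `ℚ(ζ₉)⁺` the first obstruction is at `k = 3`, not `2`: split primes with `0` or
`2` roots then have `p ≡ 1 (mod 9)`).  (iii) For the crux itself nothing changes: its `GL₃` tower
carries no self-duality, and at inert `𝔭` the conclusion's `π` simply has Satake multiset
`{-p, γ, p²/γ}` (L-normalisation, `|α| = N𝔭^{1/2}`), consistent with item 4. -/

section UnitaryInterface

open Literature.NumberTheory.Automorphic.UnitaryGroup

/-- **(a) Base-change torus parameters at a `c`-fixed place, `N = 3`.**  The Literature predicate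
`IsBaseChangeParam` forces `(β₀, β₁, β₂) = (b, 1, b⁻¹)` with `b ≠ 0` when `c • w = w`. [folklore] -/
theorem isBaseChangeParam_three_of_fixed {F E : Type} [Field F] [NumberField F] [Field E]
    [NumberField E] [Algebra F E] {c : E ≃ₐ[F] E} {w : HeightOneSpectrum (𝓞 E)} {β : Fin 3 → ℂ}
    (h : IsBaseChangeParam F E c 3 w β) (hw : c • w = w) :
    β 0 ≠ 0 ∧ β 1 = 1 ∧ β 2 = (β 0)⁻¹ := by
  obtain ⟨h0, h1⟩ := h
  have h1' := h1 hw
  refine ⟨h0 0, (h1' 1).2 rfl, ?_⟩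
  have h02 : (0 : Fin 3).rev = 2 := rfl
  have := (h1' 0).1
  rwa [h02] at this

/-- **(a') The base-change Satake multiset of a `U_{E/F}(3)`-representation at a `c`-fixed place
contains `1` and sums to `b + 1 + b⁻¹`.**  For the route (`F = ℚ`, `E = ℚ(ω)`): at every inert
prime and at `λ` the twisted-unitary stubs pin `χ(ϖ_𝔭)·(b + 1 + b⁻¹) ≡ e₀(a_𝔭 f)`. [folklore] -/
theorem hasBaseChangeSatakeAt_three_of_fixed {F E : Type} [Field F] [NumberField F] [Field E]
    [NumberField E] [Algebra F E] {c : E ≃ₐ[F] E} {hcpt : isCompact_glFiniteIntegralLevel 3 E}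
    {π : AutomorphicRepData (quasiSplitDatum F E c 3 hcpt)} {w : HeightOneSpectrum (𝓞 E)}
    {α : Multiset ℂ} (h : HasBaseChangeSatakeAt F E c 3 hcpt π w α) (hw : c • w = w) :
    ∃ b : ℂ, b ≠ 0 ∧ (1 : ℂ) ∈ α ∧ b ∈ α ∧ b⁻¹ ∈ α ∧ Multiset.card α = 3 ∧
      α.sum = b + 1 + b⁻¹ := by
  obtain ⟨𝔫, β, -, -, -, hβ, rfl, -⟩ := h
  obtain ⟨h0, h1, h2⟩ := isBaseChangeParam_three_of_fixed hβ hw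
  refine ⟨β 0, h0, ?_, ?_, ?_, by simp, ?_⟩
  · exact Multiset.mem_map.2 ⟨1, Finset.mem_univ_val 1, h1⟩
  · exact Multiset.mem_map.2 ⟨0, Finset.mem_univ_val 0, rfl⟩
  · exact Multiset.mem_map.2 ⟨2, Finset.mem_univ_val 2, h2⟩
  · rw [← Finset.sum_eq_multiset_sum, Fin.sum_univ_three, h1, h2]

end UnitaryInterface

section InertFactor

/-- **(b, algebra) Closure under `γ ↦ q/γ` plus `det = -p³` forces the root `-p`.**  If a cubic
`X³ - aX² + eX - d` over a field has its root multiset closed under `γ ↦ p²/γ` — which for the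
elementary symmetric functions means `d² = p⁶` and `e·d = a·p⁴` — and `d = -p³`, then `-p` is a
root (indeed `e = -p a` and the cubic is `(X + p)(X² - (a + p)X + p²)`). [folklore] -/
theorem root_neg_p_of_closure_of_det {L : Type*} [Field L] {p a e d : L} (hp : p ≠ 0)
    (hed : e * d = a * p ^ 4) (hd : d = -p ^ 3) :
    (X ^ 3 - C a * X ^ 2 + C e * X - C d).IsRoot (-p) ∧
      X ^ 3 - C a * X ^ 2 + C e * X - C d = (X + C p) * (X ^ 2 - C (a + p) * X + C (p ^ 2)) := by
  have he : e = -p * a := by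
    subst hd
    have hp3 : p ^ 3 ≠ 0 := pow_ne_zero 3 hp
    have : e * p ^ 3 = -(a * p) * p ^ 3 := by linear_combination -hed
    have := mul_right_cancel₀ hp3 this
    linear_combination this
  subst hd; subst he
  constructor
  · simp only [IsRoot.def, eval_sub, eval_add, eval_mul, eval_pow, eval_X, eval_C]
    ring
  · simp only [map_add, map_pow, map_neg, map_mul]
    ring

/-- **(b, linear algebra) Block anti-diagonal determinant with `3 × 3` blocks.**  Over a commutative
ring, `det (0 A; B 0) = -(det A · det B)` for `A, B : Matrix (Fin 3) (Fin 3) R` — the sign is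
`(-1)^3`.  Applied to `Frob_p = (0 A; B 0)` on `H¹(C) = V_e ⊕ V_ē` at an inert prime:
`det(Frob_𝔭 | V_e) = det(AB) = -det(Frob_p | H¹) = -p³`. [folklore] -/
theorem det_fromBlocks_zero_diag_three {R : Type*} [CommRing R] (A B : Matrix (Fin 3) (Fin 3) R) :
    (Matrix.fromBlocks 0 A B 0).det = -(A.det * B.det) := by
  have hswap : (Matrix.fromBlocks (0 : Matrix (Fin 3) (Fin 3) R) A B 0) =
      (Matrix.fromBlocks A 0 0 B) * (Matrix.fromBlocks 0 1 1 0) := by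
    simp [Matrix.fromBlocks_multiply]
  have hperm : (Matrix.fromBlocks (0 : Matrix (Fin 3) (Fin 3) R) 1 1 0) =
      (Equiv.sumComm (Fin 3) (Fin 3)).toPEquiv.toMatrix := by
    ext i j
    rcases i with i | i <;> rcases j with j | j <;>
      simp [Matrix.fromBlocks, PEquiv.toMatrix, Equiv.toPEquiv, Matrix.one_apply, eq_comm]
  have hsign : Equiv.Perm.sign (Equiv.sumComm (Fin 3) (Fin 3)) = -1 := by decide
  rw [hswap, Matrix.det_mul, Matrix.det_fromBlocks_zero₂₁, hperm, Matrix.det_permutation, hsign]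
  simp

end InertFactor

section StubShapes

/-- **Stub N's conclusion forces `3 ∣ n`** (`Fin n ≃ Fin 3 × Fin m`): at `n` prime to `3` — e.g. a
character `s` (`n = 1`) — `stub_eichlerShimuraTypic` asserts that NO continuous `s` satisfies the
Eichler–Shimura relation w.r.t. `ρ` off a finite set; on paper true under its big-image hypotheses
(a character `s` with `s(Frob_𝔭)` an eigenvalue of `ρ(Frob_𝔭)` a.e. would give every element of the
image of `ρ ⊗ s⁻¹` the eigenvalue `1`, impossible for an image with Zariski closure `⊇ SL₃`), and not
refutable in the tree (no such `ρ` is constructible). [folklore] -/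
theorem three_dvd_of_finEquiv {n m : ℕ} (e : Fin n ≃ Fin 3 × Fin m) : 3 ∣ n :=
  ⟨m, by simpa using Fintype.card_congr e⟩

end StubShapes

section Cycle4

open Literature.AlgebraicGeometry.Motives

/-! ## §13 (cycle 4) The PICKED line `split-ramified-prime-sqrt6`: an empty case split, the
remainder stub as a costume of the crux, and the load-bearing hypotheses of its Stub 1 -/

/-- **Curve-level vacuity** (paper theorem, Börner–Bouw–Wewers 2017 §3.2 Lemma 4 = `lem:genuscomp`,
arXiv:1701.01986 p. 6, read; found by the drefute seat): for every separable quartic `f ∈ ℤ[X]`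
the Picard curve `y³ = f(x)` NEVER has potentially good reduction at `3` of `3`-rank `2` — over the
absolutely unramified base `ℚ₃^{nr}` a potentially good special fibre is an étale component of
genus `3`, which has ONE branch point (lower jump `4`), i.e. is the Hermitian curve `y³ - y = x⁴`
(supersingular, `3`-rank `0`); the two-branch-point type (jumps `1, 2`) "does not occur" because
`τ : ζ₃ ↦ ζ₃²` would have to act near both ramification points with `ζ^{h_i} = -1`, forcing its
order to be `2` and `4` at once (`no_tau_for_jumps_one_two`).  Hence the tree predicate
`HasMuOrdinaryReductionAtThree` (definition request D1, CURVE-level good reduction) is empty on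
the admissible class.  Stated here as a hypothesis; not provable in the tree (stable reduction).
[cite: BornerBouwWewers2017, §3.2 Lemma 4 (arXiv:1701.01986 numbering)] -/
def CurveLevelVacuity : Prop :=
  ∀ f : ℤ[X], f.natDegree = 4 → (f.map (Int.castRingHom ℚ)).Separable →
    12 ∣ Nat.card (f.map (Int.castRingHom ℚ)).Gal → ¬ HasMuOrdinaryReductionAtThree f

/-- The statement of the line's Stub 7 `stub_nonMuOrdinaryRemainder` ("the conceded remainder"):
the crux verbatim on the admissible `f` with `¬ HasMuOrdinaryReductionAtThree f`. -/
def NonMuOrdinaryRemainder : Prop :=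
  ∀ (f : ℤ[X]) (hcpt : isCompact_glFiniteIntegralLevel 3 K), f.natDegree = 4 →
    (f.map (Int.castRingHom ℚ)).Separable → 12 ∣ Nat.card (f.map (Int.castRingHom ℚ)).Gal →
    ¬ HasMuOrdinaryReductionAtThree f → LimitHypothesis f hcpt → AutomorphyConclusion f hcpt

/-- Stub 7 is a weakening of the crux (it only adds a hypothesis). [folklore] -/
theorem nonMuOrdinaryRemainder_of_irregularClassicality (h : IrregularClassicality) :
    NonMuOrdinaryRemainder :=
  fun f hcpt hdeg hsep hgal _ hlim => h f hcpt hdeg hsep hgal hlim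

/-- **Costume.**  Under curve-level vacuity Stub 7 IS the crux: the line's case split
`by_cases HasMuOrdinaryReductionAtThree f` sends every admissible `f` to the remainder branch, so
the kernel-checked composition `IrregularClassicality_of` of `Lines/split-ramified-prime-sqrt6.lean`
(and the same split in `Lines/sen-cousin-anisotropic-saddle.lean` and in 13757's lines) makes no
inroad on the crux as typed. [folklore] -/
theorem nonMuOrdinaryRemainder_iff_of_vacuity (hvac : CurveLevelVacuity) :
    NonMuOrdinaryRemainder ↔ IrregularClassicality :=
  ⟨fun h f hcpt hdeg hsep hgal hlim => h f hcpt hdeg hsep hgal (hvac f hdeg hsep hgal) hlim,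
    nonMuOrdinaryRemainder_of_irregularClassicality⟩

/-- **Every stub guarded by `HasMuOrdinaryReductionAtThree f` is vacuously true** under curve-level
vacuity — whatever its conclusion `Q` (Stub 3 `stub_polarizedTwistedTower` and the heart Stub 5
`stub_twoWallOrdinaryClassicality` of the PICKED line have this shape, with `Q f` their remaining
binders and conclusion). [folklore] -/
theorem guardedStub_of_vacuity (hvac : CurveLevelVacuity) (Q : ℤ[X] → Prop) :
    ∀ f : ℤ[X], f.natDegree = 4 → (f.map (Int.castRingHom ℚ)).Separable →
      12 ∣ Nat.card (f.map (Int.castRingHom ℚ)).Gal → HasMuOrdinaryReductionAtThree f → Q f :=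
  fun f hdeg hsep hgal hmu => (hvac f hdeg hsep hgal hmu).elim

/-- Variant with the level datum bound before the degree hypothesis (the binder order of Stub 3). -/
theorem guardedStub_of_vacuity' (hvac : CurveLevelVacuity)
    (Q : ℤ[X] → isCompact_glFiniteIntegralLevel 3 K → Prop) :
    ∀ (f : ℤ[X]) (hcpt : isCompact_glFiniteIntegralLevel 3 K), f.natDegree = 4 →
      (f.map (Int.castRingHom ℚ)).Separable → 12 ∣ Nat.card (f.map (Int.castRingHom ℚ)).Gal →
      HasMuOrdinaryReductionAtThree f → Q f hcpt :=
  fun f _ hdeg hsep hgal hmu => (hvac f hdeg hsep hgal hmu).elim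

/-- **The combinatorial heart of the exclusion (shadow of BBW `lem:genuscomp`).**  In characteristic
`≠ 2` no single order `m` admits primitive `m`-th roots of unity `ζ₁, ζ₂` with `ζ₁¹ = -1` and
`ζ₂² = -1` — the linearised constraints `ζ^{h_i} = -1` for `τ σ τ⁻¹ = σ⁻¹` at ramification points of
lower jumps `h₁ = 1`, `h₂ = 2`. [folklore] -/
theorem no_tau_for_jumps_one_two {L : Type*} [Field L] (h2 : (2 : L) ≠ 0) {m : ℕ} {ζ₁ ζ₂ : L}
    (h₁ : IsPrimitiveRoot ζ₁ m) (h₂ : IsPrimitiveRoot ζ₂ m) (hj₁ : ζ₁ ^ 1 = -1) (hj₂ : ζ₂ ^ 2 = -1) :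
    False := by
  rw [pow_one] at hj₁
  have hm2 : m ∣ 2 := h₁.dvd_of_pow_eq_one 2 (by rw [hj₁]; norm_num)
  have hm1 : m ≠ 1 := by
    rintro rfl
    have : ζ₁ = 1 := IsPrimitiveRoot.one_right_iff.1 h₁
    rw [this] at hj₁
    exact h2 (by linear_combination hj₁)
  have hm : m = 2 := by
    rcases (Nat.dvd_prime Nat.prime_two).1 hm2 with h | h
    · exact (hm1 h).elim
    · exact h
  subst hm
  have h1 : ζ₂ ^ 2 = 1 := h₂.pow_eq_one
  rw [h1] at hj₂
  exact h2 (by linear_combination hj₂)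

/-- **Parity threshold, kernel-checked** (the three line cards' rejection of the literal
`IsConjSelfDualAE` restate rests on `ε³ ≢ 1 mod 27` on `Γ_K`, `ε(Γ_K) = 1 + 3ℤ₃`): cubes of
elements `≡ 1 (mod 3)` are `≡ 1 (mod 9)` … -/
theorem cube_of_one_mod_three_mod_nine : ∀ y : ZMod 9, (1 + 3 * y) ^ 3 = 1 := by decide

/-- … but not `≡ 1 (mod 27)`: `4³ = 64 ≡ 10`.  So an exactly conjugate-self-dual regular tower can
match `ρ_C` to depth `3^{k-1} ∣ 9` at most, i.e. `k ≤ 3` ("`k ≥ 4` safe" in the parity notes).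
[folklore] -/
theorem exists_cube_of_one_mod_three_ne_one_mod_twentyseven : ∃ y : ZMod 27, (1 + 3 * y) ^ 3 ≠ 1 :=
  ⟨1, by decide⟩

/-! ### Stub 1 `stub_placeOfMaximalIdeal`: both hypotheses on `𝔐` are load-bearing -/

/-- The displayed property of Stub 1 for a given ideal `𝔐` and isomorphism `ι : ℚ̄₃ ≃ ℂ`:
`𝔐`-adic divisibility by `3^k` implies `3`-adic smallness `‖ι⁻¹ z‖ ≤ 3^{-k}`. -/
def IsAdaptedIso (𝔐 : Ideal Zbar) (ι : PadicAlgCl 3 ≃+* ℂ) : Prop :=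
  ∀ (z : Zbar) (k : ℕ), (∃ u : Zbar, u ∉ 𝔐 ∧ u * z ∈ Ideal.span {(3 : Zbar) ^ k}) →
    ‖ι.symm (z : ℂ)‖ ≤ ((3 : ℝ)⁻¹) ^ k

/-- Stub 1 restated with `IsAdaptedIso` (definitionally the skeleton's `stub_placeOfMaximalIdeal`). -/
def PlaceOfMaximalIdeal : Prop :=
  ∀ 𝔐 : Ideal Zbar, 𝔐.IsMaximal → (3 : Zbar) ∈ 𝔐 → ∃ ι : PadicAlgCl 3 ≃+* ℂ, IsAdaptedIso 𝔐 ι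

/-- `‖3‖ = 3⁻¹` in `ℚ̄₃ = PadicAlgCl 3`. [folklore] -/
theorem norm_three_padicAlgCl : ‖(3 : PadicAlgCl 3)‖ = (3 : ℝ)⁻¹ := by
  have h := PadicAlgCl.norm_extends 3 ((3 : ℕ) : ℚ_[3])
  rw [map_natCast, Padic.norm_p] at h
  exact_mod_cast h

/-- **Stub 1 is false without `3 ∈ 𝔐`**: at a maximal `𝔐` above `2` the element `u := 3 ∉ 𝔐`
serves every `z`, so adaptedness would force `‖ι⁻¹ 1‖ = 1 ≤ 3⁻¹`. [folklore] -/
theorem placeOfMaximalIdeal_false_without_three_mem :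
    ¬ ∀ 𝔐 : Ideal Zbar, 𝔐.IsMaximal → ∃ ι : PadicAlgCl 3 ≃+* ℂ, IsAdaptedIso 𝔐 ι := by
  intro h
  obtain ⟨𝔐, h𝔐, -, h3⟩ := exists_isMaximal_two_mem_three_not_mem
  obtain ⟨ι, hι⟩ := h 𝔐 h𝔐
  have h1 := hι 1 1 ⟨3, h3, by rw [mul_one, pow_one]; exact Ideal.mem_span_singleton_self _⟩
  simp only [OneMemClass.coe_one, map_one, norm_one, pow_one] at h1
  norm_num at h1

/-- `3` is not a unit of `ℤ̄` (there is a maximal ideal above it). [folklore] -/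
theorem span_three_ne_top : Ideal.span {(3 : Zbar)} ≠ ⊤ := by
  obtain ⟨𝔐, h𝔐, h3⟩ := exists_isMaximal_three_mem
  exact fun htop => h𝔐.ne_top (top_le_iff.1 (htop ▸ (Ideal.span_singleton_le_iff_mem _).2 h3))

/-- **Stub 1 is false with `IsMaximal` weakened to "proper"**: for `𝔐 = 3ℤ̄ ∋ 3` take `z = u = √3`:
`u ∉ 3ℤ̄` (else `3` would be a unit), `u z = 3 ∈ (3¹)`, yet `‖ι⁻¹ √3‖ = 3^{-1/2} > 3⁻¹` for EVERY
`ι` (`‖ι⁻¹ √3‖² = ‖3‖ = 3⁻¹`).  Maximality is what pins ONE `3`-adic place (cf. §10, item 15).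
[folklore] -/
theorem placeOfMaximalIdeal_false_without_isMaximal :
    ¬ ∀ 𝔐 : Ideal Zbar, 𝔐 ≠ ⊤ → (3 : Zbar) ∈ 𝔐 → ∃ ι : PadicAlgCl 3 ≃+* ℂ, IsAdaptedIso 𝔐 ι := by
  intro h
  obtain ⟨ι, hι⟩ := h _ span_three_ne_top (Ideal.mem_span_singleton_self 3)
  -- a square root of 3 in ℂ, an algebraic integer
  obtain ⟨s, hs⟩ := IsAlgClosed.exists_pow_nat_eq (3 : ℂ) two_pos
  have hsint : IsIntegral ℤ s := by
    refine ⟨X ^ 2 - C 3, monic_X_pow_sub_C 3 two_ne_zero, ?_⟩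
    simp [hs]
  let sZ : Zbar := ⟨s, (mem_integralClosure_iff ℤ ℂ).2 hsint⟩
  have h3coe : ((3 : Zbar) : ℂ) = 3 := map_ofNat (integralClosure ℤ ℂ).val 3
  have hss : sZ * sZ = 3 := by
    apply Subtype.ext
    change s * s = ((3 : Zbar) : ℂ)
    rw [h3coe, ← pow_two, hs]
  have hsn : sZ ∉ Ideal.span {(3 : Zbar)} := by
    intro hmem
    obtain ⟨r, hr⟩ := Ideal.mem_span_singleton'.1 hmem
    -- sZ = r * 3 ⇒ 3 = sZ² = 9 r² ⇒ 3 (r² · 3 - 1) = 0 ⇒ r² · 3 = 1 ⇒ 3 is a unit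
    apply span_three_ne_top
    rw [Ideal.eq_top_iff_one, Ideal.mem_span_singleton']
    have h9 : (3 : Zbar) * (r * r * 3) = 3 * 1 := by linear_combination (3 * r + sZ) * hr + hss
    have h3ne : (3 : Zbar) ≠ 0 := fun h0 => by
      have := congrArg Subtype.val h0
      norm_num at this
    exact ⟨r * r, mul_left_cancel₀ h3ne h9⟩
  have hle := hι sZ 1 ⟨sZ, hsn, by rw [hss, pow_one]; exact Ideal.mem_span_singleton_self _⟩
  -- ‖ι.symm s‖ ≤ 3⁻¹ but its square is ‖ι.symm 3‖ = 3⁻¹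
  have hsq : ‖ι.symm (sZ : ℂ)‖ * ‖ι.symm (sZ : ℂ)‖ = (3 : ℝ)⁻¹ := by
    rw [← norm_mul, ← map_mul]
    have : (sZ : ℂ) * (sZ : ℂ) = 3 := by rw [← MulMemClass.coe_mul, hss]; exact h3coe
    rw [this, map_ofNat, norm_three_padicAlgCl]
  rw [pow_one] at hle
  nlinarith [norm_nonneg (ι.symm (sZ : ℂ))]

/-! ### The restated (twisted-polarized) interface at conjugation-fixed places: `±1 ∈ Sat(Π, w)` -/

/-- **An inversion-stable multiset of odd cardinality has a self-inverse member** (pair `b ↔ b⁻¹`).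
[folklore] -/
theorem exists_inv_eq_self_of_map_inv_eq {F : Type*} [DivisionRing F] :
    ∀ (n : ℕ) (s : Multiset F), Multiset.card s = n → s.map (·⁻¹) = s → Odd n →
      ∃ b ∈ s, b⁻¹ = b := by
  intro n
  induction n using Nat.strong_induction_on with
  | _ n ih =>
    intro s hn hs hodd
    by_contra hne
    push Not at hne
    have hpos : 0 < Multiset.card s := by rw [hn]; exact hodd.pos
    obtain ⟨a, ha⟩ := Multiset.card_pos_iff_exists_mem.1 hpos
    have ha' : a⁻¹ ∈ s := by
      have := Multiset.mem_map_of_mem (·⁻¹) ha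
      rwa [hs] at this
    have hne_a : a⁻¹ ≠ a := hne a ha
    set s₂ := (s.erase a).erase a⁻¹ with hs₂def
    have hdec : s = a ::ₘ a⁻¹ ::ₘ s₂ := by
      rw [hs₂def, Multiset.cons_erase ((Multiset.mem_erase_of_ne hne_a).2 ha'), Multiset.cons_erase ha]
    have hs₂ : s₂.map (·⁻¹) = s₂ := by
      have h := hs
      rw [hdec, Multiset.map_cons, Multiset.map_cons, inv_inv, Multiset.cons_swap] at h
      exact (Multiset.cons_inj_right _).1 ((Multiset.cons_inj_right _).1 h)
    have hcard₂ : Multiset.card s₂ + 2 = n := by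
      rw [← hn, hdec]; simp
    have hodd₂ : Odd (Multiset.card s₂) := by
      obtain ⟨k, hk⟩ := hodd
      exact ⟨k - 1, by omega⟩
    have hsub : ∀ b ∈ s₂, b ∈ s := fun b hb =>
      Multiset.mem_of_mem_erase (Multiset.mem_of_mem_erase hb)
    obtain ⟨b, hb, hbb⟩ := ih (Multiset.card s₂) (by omega) s₂ rfl hs₂ hodd₂
    exact hne b (hsub b hb) hbb

/-- Hence, in a field, an inversion-stable multiset of odd cardinality avoiding `0` contains `1` or
`-1`. [folklore] -/
theorem one_mem_or_neg_one_mem_of_map_inv_eq {F : Type*} [Field F] {s : Multiset F}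
    (hs : s.map (·⁻¹) = s) (hodd : Odd (Multiset.card s)) (h0 : ∀ a ∈ s, a ≠ 0) :
    (1 : F) ∈ s ∨ (-1 : F) ∈ s := by
  obtain ⟨b, hb, hbb⟩ := exists_inv_eq_self_of_map_inv_eq _ s rfl hs hodd
  have hb0 := h0 b hb
  have hb1 : b * b = 1 := by
    calc b * b = b⁻¹ * b := by rw [hbb]
      _ = 1 := inv_mul_cancel₀ hb0
  rcases mul_self_eq_one_iff.1 hb1 with rfl | rfl
  · exact Or.inl hb
  · exact Or.inr hb

/-- **Shape of the RESTATED interface at `c`-fixed places** (the twisted-polarized normal form all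
three line cards and the parity note recommend for 13757 → 13758: members `Π_k` regular algebraic
cuspidal on `GL₃(𝔸_K)` with `IsConjSelfDualAE c₀`).  UNCONDITIONALLY (Satake parameters are
non-zero, `hasSatakeParamAt_ne_zero_holds`; `card = 3`): at all but finitely many `c`-fixed places
`w` — for the route the inert primes `(p)`, `p ≡ 2 (3)`, and `λ` — every Satake parameter of a
conjugate-self-dual `Π` on `GL₃` CONTAINS `1` OR `-1` (it is `{±1, b, b⁻¹}` or `⊆ {±1}`).  Paper
complement (with §12(b)): the congruence `N𝔭·ΣSat(Π_k,(p)) ≡ e(a_𝔭(f)·ϖ_𝔭) = p² - p(γ + p²/γ)`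
(`ϖ_{(p)} = -p`, `Frob`-eigenvalues `{-p, γ, p²/γ}` on `V_e`) forces the self-inverse parameter to
be `+1` and `b ≡ -γ/p` for large `k` (`-p² ≢ p² mod 3`): `N𝔭·Sat(Π_k,(p)) → {p², -pγ, -p³/γ}`, the
spectrum of `(ρ_C ⊗ ψ)(Frob_𝔭)` — the restated interface passes the inert consistency test, and a
candidate tower with self-inverse parameter `-1` at infinitely many inert primes is NOT admissible
(a cheap numerical test for 13757's provers).  GL₃-side twin of §12(a). [folklore] -/
theorem one_mem_or_neg_one_mem_satake_of_isConjSelfDualAE {F E : Type} [Field F] [NumberField F]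
    [Field E] [NumberField E] [Algebra F E] {hcpt : isCompact_glFiniteIntegralLevel 3 E}
    {P : AutomorphicRepData (AutomorphyDatum.gl 3 E hcpt)} {c : E ≃ₐ[F] E}
    (h : P.IsConjSelfDualAE c) :
    ∀ᶠ w : HeightOneSpectrum (𝓞 E) in cofinite, c • w = w → ∀ α : Multiset ℂ,
      P.HasSatakeParamAt w α → (1 : ℂ) ∈ α ∨ (-1 : ℂ) ∈ α := by
  refine h.mono fun w hw hcw α hα => ?_
  have hinv : α.map (·⁻¹) = α := (hw α α hα (by rw [hcw]; exact hα)).symm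
  refine one_mem_or_neg_one_mem_of_map_inv_eq hinv ?_ (hasSatakeParamAt_ne_zero_holds hα)
  rw [hα.card_eq]
  decide

/-! ### The restated crux (twisted-polarized hypothesis) is still a weakening of X -/

/-- The RESTATED limit hypothesis in the twisted-polarized normal form recommended by the three line
cards, the parity note and the drefute (= the conclusion shape of Stub 3 `stub_polarizedTwistedTower`):
primary generators `ϖ` off `S`, complex conjugation `c₀ ≠ 1`, and for every `k` a regular algebraic,
EXACTLY conjugate-self-dual cuspidal `Π_k` with `N𝔭·ΣSat(Π_k,𝔭) ≡ e(a_𝔭(f)·ϖ_𝔭) (mod 3^k ℤ̄_𝔐)`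
off `S`. -/
def TwistedPolarizedLimitHypothesis (f : ℤ[X]) (hcpt : isCompact_glFiniteIntegralLevel 3 K) : Prop :=
  ∃ (e : K →+* ℂ) (𝔐 : Ideal Zbar) (S : Finset (HeightOneSpectrum (𝓞 K))) (c₀ : K ≃ₐ[ℚ] K)
    (ϖ : HeightOneSpectrum (𝓞 K) → 𝓞 K), 𝔐.IsMaximal ∧ (3 : Zbar) ∈ 𝔐 ∧ c₀ ≠ 1 ∧
    (∀ 𝔭 ∉ S, 𝔭.asIdeal = Ideal.span {ϖ 𝔭} ∧ ϖ 𝔭 - 1 ∈ Ideal.span {(3 : 𝓞 K)}) ∧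
    ∀ k : ℕ, ∃ P : CuspidalAutomorphicRepData 3 K hcpt, P.1.IsRegularAlgebraic ∧
      P.1.IsConjSelfDualAE c₀ ∧
      ∀ 𝔭 ∉ S, ∃ (α : Multiset ℂ) (t u : Zbar), P.1.HasSatakeParamAt 𝔭 α ∧
        (t : ℂ) = (𝔭.residueCard : ℂ) * α.sum - e (↑(picardTrace f 𝔭 * ϖ 𝔭)) ∧ u ∉ 𝔐 ∧
        u * t ∈ Ideal.span {(3 : Zbar) ^ k}

/-- The crux restated with the twisted-polarized hypothesis. -/
def IrregularClassicalityTwisted : Prop :=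
  ∀ (f : ℤ[X]) (hcpt : isCompact_glFiniteIntegralLevel 3 K), f.natDegree = 4 →
    (f.map (Int.castRingHom ℚ)).Separable → 12 ∣ Nat.card (f.map (Int.castRingHom ℚ)).Gal →
    TwistedPolarizedLimitHypothesis f hcpt → AutomorphyConclusion f hcpt

/-- **The restate opens no `_false_without_` room**: it changes the hypothesis only, so it is still
implied by X (and — on paper, by untwisting `Π_k ⊗ ψ⁻¹` — by the current crux; the tree lacks the CM
character `ψ` as a `HeckeCharacter`, so that implication is not formalised). [folklore] -/
theorem irregularClassicalityTwisted_of_picardAutomorphy (hX : PicardAutomorphy) :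
    IrregularClassicalityTwisted :=
  fun f hcpt hdeg hsep hgal _ => hX f hcpt hdeg hsep hgal

/-- **Members of a restated tower have `±1` in their Satake parameters at almost every `c₀`-fixed
place** (specialisation of `one_mem_or_neg_one_mem_satake_of_isConjSelfDualAE` to `K = ℚ(ω)`; for
the inert primes `c₀ • 𝔭 = 𝔭` holds on paper — `c₀` is complex conjugation and `(p)` is
`Gal`-stable). [folklore] -/
theorem twistedTower_member_one_mem_or_neg_one_mem {hcpt : isCompact_glFiniteIntegralLevel 3 K}
    {P : CuspidalAutomorphicRepData 3 K hcpt} {c₀ : K ≃ₐ[ℚ] K} (h : P.1.IsConjSelfDualAE c₀) :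
    ∀ᶠ 𝔭 : HeightOneSpectrum (𝓞 K) in cofinite, c₀ • 𝔭 = 𝔭 → ∀ α : Multiset ℂ,
      P.1.HasSatakeParamAt 𝔭 α → (1 : ℂ) ∈ α ∨ (-1 : ℂ) ∈ α :=
  one_mem_or_neg_one_mem_satake_of_isConjSelfDualAE h

end Cycle4

end

end Summit.Langlands.Langlands.Cruxes.IrregularClassicality.Disproof
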